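import Mathlib.Analysis.SpecialFunctions.Log.Basic
import Mathlib.Analysis.SpecialFunctions.Exp
import Mathlib.Algebra.BigOperators.Intervals
import Mathlib.Analysis.SpecificLimits.Basic
import Literature.Analysis.Asymptotics.PoincareRatioTheorem
import Literature.NumberTheory.Irrationality.Zudilin2003.CatalanRecursion
import Literature.NumberTheory.Irrationality.Zudilin2003.CatalanSeries
import Literature.NumberTheory.Irrationality.Zudilin2003.Theorem1
import HarnessLib

/-!
# Zudilin 2003 (Catalan's constant), the rates after Theorem 1 PROVED — Literature-side DISCHARGE of `Zudilin2003.rates`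

RE-HOMED into Literature (seat zeta5-irr-lit g8, 2026-08-27; HIDDEN-DISCHARGES sweep row `rates`,
run/shared/lean/pub/bsd-rank2/lit/HIDDEN-DISCHARGES.md — a Literature named fact whose proof lived only under Summits/):
this file is a verbatim twin of the cell's typer line
`Summits/KontsevichZagierPeriods/Zeta5Search/{RecurrenceGrowth, Zudilin2003Growth, Zudilin2003Casoratian, Zudilin2003ExactRates,
TailSqueeze, Zudilin2003ExactDecay}.lean` plus the first block of `Zudilin2003Rates.lean` (cell `pub-zeta5`, TYPER seats g1–g5 — the
authors of the mathematics), with the single namespace change `Summit.KontsevichZagierPeriods.Zeta5Search` ↦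
`Literature.NumberTheory.Irrationality.Zudilin2003` (so `Zudilin2003Growth.*`, `TailSqueeze.*` and the generic recurrence tools keep
their relative names) and the discharge `Literature.NumberTheory.Irrationality.Zudilin2003.rates_holds : rates` declared in the fact's
namespace; cite tags added per declaration. The eight small real-valued definitions of the line (`uR`, `vR`, `LC`, `TC`, `sC`, `tC`,
`casW`, `approx` — normalisations of the tree's `Zudilin2003.u`, `.v` and of the recursion's coefficients) are copied with it; NO new
named fact (net debt −1). Not copied: the cell-internal certificate bookkeeping of `Zudilin2003Rates.lean` (`CatalanFamily.*`,
`no_certificate_catalan_holds`), which concerns the cell's search formats, not the source.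

What is proved, as printed [Zudilin2003Catalan, Sect. 1, after Theorem 1]: "The characteristic polynomial λ² − 11λ − 1 with zeros
((1 ± √5)/2)⁵ of the difference equation (2) … Therefore application of Poincaré's theorem (see also [Zu1, Proposition 2]) yields the
limit relations lim u_n^{1/n} = lim v_n^{1/n} = ((1+√5)/2)⁵ = exp(2.40605912…), lim |u_nG − v_n|^{1/n} = |(1−√5)/2|⁵ =
exp(−2.40605912…)" — the tree's `rates` = (`uₙ^{1/n} → ((1+√5)/2)⁵`) ∧ (`∀ n, uₙG − vₙ ≠ 0`) ∧ (`|uₙG − vₙ|^{1/n} → ((√5−1)/2)⁵`).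
Route = the typer line's: a kernel-certified ratio box `15/2 ≤ u_{n+1}/uₙ ≤ 557/50` (ratio induction for a recurrence with `tₙ < 0`),
Abel's formula for the Casoratian, Poincaré's theorem under an a-priori bracket (the tree's
`Literature.Analysis.Asymptotics.PoincareRecurrence.tendsto_ratio_of_recurrence₂`, Elaydi Thm 7.10) for the EXACT growth, the sign-free
tail squeeze for the EXACT decay of `uₙL − vₙ` at the limit `L` of `vₙ/uₙ`, and the identification `L = G`
(`Zudilin2003.tendsto_v_div_u`, `CatalanSeries.lean`; `Zudilin2003.theorem1_holds`, `Theorem1.lean`).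
HONEST FRAMING (cell pub-zeta5 / zeta5-irr): nothing here is an irrationality result (G is not known to be irrational; the
forms `2^{4n+3}D_{2n−1}^3(uₙG − vₙ)` "do not tend to 0"); no rung of the cell's ladder moves.

## References
* [Zudilin2003Catalan] W. Zudilin, *An Apéry-like difference equation for Catalan's constant*, Electron. J. Combin. 10 (2003),
  #R14, arXiv:math/0201024 (held text `paper:arxiv-math_0201024`, Sect. 1 re-read on the page by the re-homing seat).

The six original module headers follow verbatim.

## (1/6) `RecurrenceGrowth.lean`
# ζ(5) search — growth and Casoratian of second-order recurrences (cell `pub-zeta5`, TYPER)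

HONEST FRAMING: systematic search; no irrationality claim unless certified.

Generic, Poincaré–Perron-free tools that turn a second-order linear recurrence
`y (n+2) = s n · y (n+1) - t n · y n` (the Apéry / Zeilberger–Zudilin shape, `s n = P₁(n)/P₂(n)`,
`t n = P₀(n)/P₂(n)`) into the finitary fields of the cell's recurrence-first certificate
`ApproximationCertificate` (`ApproximationCertificate.lean`; cell `CRITERIA.md`, FORMAT A):

* `casoratian_succ`, `casoratian_eq_prod_mul` — **Abel's formula**: for two solutions `u, v` the
  Casoratian `W n = u n · v (n+1) - u (n+1) · v n` satisfies `W (n+1) = t n · W n`, hence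
  `W n = (∏_{N ≤ i < n} t i) · W N` — so `casorati_le` / `casorati_ne` are identities;
* `ratio_bounds_of_recurrence` — **ratio induction**: if `t n ≥ 0` and rational brackets
  `0 < λ ≤ Λ` satisfy `λ + t n/λ ≤ s n ≤ Λ + t n/Λ` for `n ≥ N` (i.e. `λ, Λ` enclose the dominant
  root of `x² - s x + t`), and the two initial ratios lie in `[λ, Λ]`, then
  `λ u n ≤ u (n+1) ≤ Λ u n` and `u n > 0` for all `n ≥ N` (this is how the tree bounds Apéry's
  `q_{n,n}`, `Literature.NumberTheory.Transcendental.Apery.qT_diag_growth`, made generic);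
* `le_of_ratio_lower`, `le_of_ratio_upper`, `eventually_exp_le_of_ratio`,
  `eventually_le_exp_of_ratio` — from ratio bounds to `u N λ^{n-N} ≤ u n ≤ u N Λ^{n-N}` and to the
  certificate fields `e^{Q n} ≤ u n` (`Q < log λ`), `u n ≤ e^{Q' n}` (`log Λ < Q'`) for large `n`;
* `ratio_bounds_of_recurrence_neg` — the same ratio induction when `t n ≤ 0` (decreasing ratio
  map; Zudilin 2003 / Catalan shape): invariance of `[λ, Λ]` iff `λ ≤ s n - t n/Λ` and
  `s n - t n/λ ≤ Λ` (appended by typer g2).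

Everything is PROVED; no definitions, no named facts. Pure sequence lemmas (no `ζ`-specific input).

## (2/6) `Zudilin2003Growth.lean`
# ζ(5) search — kernel-certified growth of Zudilin's Catalan denominators `uₙ` (cell `pub-zeta5`, TYPER)

HONEST FRAMING: systematic search; no irrationality claim unless certified.

The Catalan arm (criterion C3) of the certified-asymptotics programme: Zudilin 2003 (Electron. J.
Combin. 10, #R14), the SECOND-order Apéry-like recursion (2) for Catalan's constant, with its
solution `uₙ` (`u₀ = 1, u₁ = 7/4`), typed in the tree as
`Literature.NumberTheory.Irrationality.Zudilin2003.u` (`= sol 1 (7/4)`, `sol_step`). Its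
characteristic polynomial `x² - 11x - 1` has roots of OPPOSITE signs (`(11 ± 5√5)/2`), so the
ratio map `r ↦ sₙ + |tₙ|/r` is decreasing and the tool is
`RecurrenceGrowth.ratio_bounds_of_recurrence_neg` (appended for this purpose). The kernel certifies

* `ratio_bounds` — for every `n ≥ 2`: `uₙ > 0` and `(15/2) uₙ ≤ u_{n+1} ≤ (557/50) uₙ`;
* `u_le`, `le_u` — `(649/64)(15/2)^m ≤ u_{2+m} ≤ (649/64)(557/50)^m`;
* `eventually_u_le_exp` — `uₙ ≤ e^{Q' n}` for all large `n`, for every `Q' > log (557/50) = 2.4105…`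
  (the paper's rate, a named fact `Zudilin2003.rates` in the tree: `log ((11+5√5)/2) = 2.40606…`;
  the lower bracket `15/2` is crude because the box must contain `u₃/u₂ = 7.5004`).

Method: `u_{m+2} = s_m u_{m+1} - t_m u_m` with `s_m = q(m+1)/L_m > 0`,
`t_m = -(2m+1)²(2m+2)² p(m+2)/L_m < 0`, `L_m = (2m+3)²(2m+4)² p(m+1) > 0`; the two corner
inequalities of the box `[15/2, 557/50]` from `m = 2` on are degree-6 polynomials in `k = m - 2`
with NONNEGATIVE integer coefficients (`ring` + `positivity`); `u₂ = 649/64`, `u₃ = 19471/256` by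
`norm_num`. Everything is PROVED (0 sorry); inputs are the tree's definitions only.

## (3/6) `Zudilin2003Casoratian.lean`
# ζ(5) search — Casoratian and convergence of Zudilin's Catalan approximants (cell `pub-zeta5`, TYPER)

HONEST FRAMING: systematic search; no irrationality claim unless certified.

Sequel of `Zudilin2003Growth.lean` (Catalan arm, criterion C3): the remaining FORMAT A fields for
Zudilin's 2003 second-order recursion — here Abel's formula (`RecurrenceGrowth.casoratian_eq_prod_mul`)
gives the Casoratian in CLOSED form, so everything is an identity plus the growth bracket:

* `vR_rec` — the second printed solution `vₙ` (`v₀ = 0, v₁ = 13/8`) solves the same recursion;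
* `casoratian_eq` — `uₙ v_{n+1} - u_{n+1} vₙ = (∏_{i<n} tᵢ) · 13/8` with `-1 ≤ tᵢ < 0`
  (`abs_tC_le_one`: the cleared inequality `TC ≤ LC` is a polynomial with nonnegative coefficients);
* `casoratian_ne_zero`, `abs_casoratian_le` — `uₙ v_{n+1} ≠ u_{n+1} vₙ` and
  `|uₙ v_{n+1} - u_{n+1} vₙ| ≤ 13/8` for every `n`;
* `abs_ratio_step_le`, `exists_limit` — `|v_{3+m}/u_{3+m} - v_{2+m}/u_{2+m}| ≤ K θ^m` with
  `K = (13/8)/((649/64)² · (15/2))`, `θ = 4/225 = (2/15)²` (`log θ = -4.03…`; the paper's rate is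
  `2 log((1+√5)/2)⁵ = 4.81`), hence `vₙ/uₙ` converges to some `L` with
  `|v_{2+m}/u_{2+m} - L| ≤ K θ^m/(1-θ)`;
* `abs_sub_catalan_le_of_theorem1` — CONDITIONAL on the tree's named fact `Zudilin2003.theorem1`
  (`vₙ/uₙ → G`), the same bound for `|G - v_{2+m}/u_{2+m}|`.

Everything is PROVED (0 sorry); inputs are the tree's definitions only.

## (4/6) `Zudilin2003ExactRates.lean`
# ζ(5) search — EXACT growth rate of Zudilin's Catalan approximants by Poincaré's theorem (cell `pub-zeta5`, TYPER)

HONEST FRAMING: systematic search; no irrationality claim unless certified.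

Catalan arm, sequel of `Zudilin2003Growth.lean` (kernel-certified ratio box
`15/2 ≤ u_{n+1}/uₙ ≤ 557/50`, `n ≥ 2`, for the denominators `uₙ` of Zudilin's 2003 second-order
recursion (2) for Catalan's constant, `Literature.NumberTheory.Irrationality.Zudilin2003.u`) and
`Zudilin2003Casoratian.lean`. With the tree's Poincaré theorem under an a-priori bracket
(`Literature.Analysis.Asymptotics.PoincareRecurrence.tendsto_ratio_of_recurrence₂`, Elaydi Thm 7.10)
and Elaydi's Lemma 7.14 the box becomes an EXACT limit:

* `tendsto_sC`, `tendsto_tC` — the coefficients of `u_{m+2} = s_m u_{m+1} - t_m u_m` tend to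
  `11` and `-1` (limiting equation `λ² = 11λ + 1`, Zudilin's characteristic polynomial, roots
  `((1 ± √5)/2)⁵`);
* `tendsto_ratio_uR` — `u_{n+1}/uₙ → ((1+√5)/2)⁵ = (11+5√5)/2 = 11.0901…` (contraction constant
  `1/(15/2)² < 1`); `tendsto_log_u_div` — `log uₙ / n → log ((1+√5)/2)⁵ = 2.40605912…`;
* the same for the numerators `vₙ` (`vR_ratio_bounds`: the box `[15/2, 557/50]` again, initial
  ratios `v₃/v₂ = 7.5013…`), `tendsto_log_v_div`;
* `tendsto_root_u` — `uₙ^{1/n} → ((1+√5)/2)⁵`: literally the FIRST conjunct of the tree's NAMED FACT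
  `Zudilin2003.rates` ("`lim u_n^{1/n} = ((1+√5)/2)⁵`", stated after Theorem 1 with a reference to
  Poincaré's theorem), now a THEOREM of the tree (unconditional, 0 sorry). The other two conjuncts
  (`uₙG - vₙ ≠ 0` and the decay rate `((√5-1)/2)⁵`) are the analytic content and remain cited.

## (5/6) `TailSqueeze.lean`
# ζ(5) search — tail squeeze: exact approximation rates from geometrically shrinking steps (cell `pub-zeta5`, TYPER)

HONEST FRAMING: systematic search; no irrationality claim unless certified.

A small real-analysis tool used by the cell's exact-rate files. Let `r : ℕ → ℝ` converge to `L`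
(think `rₙ = vₙ/uₙ`, the approximants of a recurrence family) and suppose the steps
`dₙ = r_{n+1} - rₙ` shrink geometrically from `n₀` on: `|d_{k+1}| ≤ θ|d_k|` (`k ≥ n₀`, `0 ≤ θ < 1`).
For the cell's families `d_k = ±W_k/(u_k u_{k+1})` with `W` the Casoratian, so `θ` = (Casoratian ratio
bound)/(growth ratio bound)² is tiny (Apéry `1/33²`, Zudilin 2003 `1/7.5²`, Zudilin 2002 `1045/796²`).
Then, WHATEVER THE SIGNS of the steps:

* `abs_lim_sub_le` — `|L - rₙ| ≤ |dₙ|/(1 - θ)`;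
* `abs_lim_sub_ge` — `(1 - 2θ)/(1 - θ) · |dₙ| ≤ |L - rₙ|` (non-trivial for `θ < 1/2`);
* `lim_sub_ne_zero` — hence `L ≠ rₙ` for `n ≥ n₀` when `θ < 1/2` and `dₙ ≠ 0`;
* `tendsto_log_abs_lim_sub_div` — if moreover `log|dₙ|/n → ρ` then `log|L - rₙ|/n → ρ`:
  the approximation rate is EXACTLY the step rate.

Elementary (triangle inequality + geometric series + passage to the limit); 0 sorry. [folklore]

## (6/6) `Zudilin2003ExactDecay.lean`
# ζ(5) search — Catalan arm: EXACT decay of Zudilin's 2003 forms; `theorem1 → rates` (cell `pub-zeta5`, TYPER)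

HONEST FRAMING: systematic search; no irrationality claim unless certified.

Sequel of `Zudilin2003ExactRates.lean` (growth `uₙ^{1/n} → ((1+√5)/2)⁵` PROVED) for Zudilin's
second-order recursion (2) for Catalan's constant (`Literature.…Zudilin2003.{u, v, form, theorem1,
rates}`). The recursion has `tₙ < 0`, so the Casoratian `Wₙ = uₙv_{n+1} - u_{n+1}vₙ = (∏ tᵢ)·13/8`
ALTERNATES and the same-sign telescoping of `RecurrenceCertificateDecay.lean` does not apply; the
sign-free `TailSqueeze` does, with the contraction constant `θ = 1/50`
(`|d_{n+1}/dₙ| = |tₙ| uₙ/u_{n+2} ≤ 1/7.5²` for `n ≥ 2`, and `0.0137`, `0.0089` at `n = 0, 1`). PROVED: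

* `tendsto_log_abs_casW_div` — `log|Wₙ|/n → 0` (`W_{n+1}/Wₙ = tₙ → -1`);
* `tendsto_log_abs_step_div` — `log|v_{n+1}/u_{n+1} - vₙ/uₙ|/n → -2 log λ∞`, `λ∞ = ((1+√5)/2)⁵`;
* for THE LIMIT `L` of `vₙ/uₙ` (it exists: `Zudilin2003Casoratian.exists_limit`), unconditionally:
  `form_ne_zero_of_tendsto` — `uₙL - vₙ ≠ 0` for EVERY `n`; `tendsto_log_abs_form_div_of_tendsto` —
  `log|uₙL - vₙ|/n → -log λ∞`; `tendsto_root_abs_form_of_tendsto` — `|uₙL - vₙ|^{1/n} → ((√5-1)/2)⁵`;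
* `rates_of_theorem1` — **`Zudilin2003.theorem1 → Zudilin2003.rates`**: granted only the
  identification `vₙ/uₙ → G` (the analytic content of Theorem 1, a cited fact), ALL THREE conjuncts
  of the cited `rates` (growth, non-vanishing of `uₙG - vₙ` for all `n`, decay `((√5-1)/2)⁵`) are
  theorems of the tree. (The growth conjunct is unconditional: `tendsto_root_u`.)
-/

noncomputable section

/-! ## (1/6) `RecurrenceGrowth.lean` -/

section

open Filter Topology Finset

namespace Literature.NumberTheory.Irrationality.Zudilin2003

/-! ### Abel's formula for the Casoratian -/

/-- **Abel's formula, one step.** Two solutions `u, v` of `y (n+2) = s n y (n+1) - t n y n` have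
`u (n+1) v (n+2) - u (n+2) v (n+1) = t n · (u n v (n+1) - u (n+1) v n)`.
[cite: Zudilin2003Catalan, Sect. 1, the display after Theorem 1 ("application of Poincaré's theorem … yields the limit relations") — generic second-order-recurrence tool of that application] -/
theorem casoratian_succ {R : Type*} [CommRing R] (u v s t : ℕ → R) (n : ℕ)
    (hu : u (n + 2) = s n * u (n + 1) - t n * u n)
    (hv : v (n + 2) = s n * v (n + 1) - t n * v n) :
    u (n + 1) * v (n + 2) - u (n + 2) * v (n + 1) =
      t n * (u n * v (n + 1) - u (n + 1) * v n) := by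
  rw [hu, hv]; ring

/-- **Abel's formula.** For two solutions `u, v` of `y (n+2) = s n y (n+1) - t n y n` (`n ≥ N`),
the Casoratian is `u n v (n+1) - u (n+1) v n = (∏_{i ∈ [N, n)} t i) · (u N v (N+1) - u (N+1) v N)`
for all `n ≥ N`.
[cite: Zudilin2003Catalan, Sect. 1, the display after Theorem 1 ("application of Poincaré's theorem … yields the limit relations") — generic second-order-recurrence tool of that application] -/
theorem casoratian_eq_prod_mul {R : Type*} [CommRing R] (u v s t : ℕ → R) (N : ℕ)
    (hu : ∀ n, N ≤ n → u (n + 2) = s n * u (n + 1) - t n * u n)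
    (hv : ∀ n, N ≤ n → v (n + 2) = s n * v (n + 1) - t n * v n) :
    ∀ n, N ≤ n → u n * v (n + 1) - u (n + 1) * v n =
      (∏ i ∈ Ico N n, t i) * (u N * v (N + 1) - u (N + 1) * v N) := by
  refine Nat.le_induction (by simp) fun n hn ih => ?_
  rw [show n + 1 + 1 = n + 2 by ring, casoratian_succ u v s t n (hu n hn) (hv n hn), ih,
    Finset.prod_Ico_succ_top hn]
  ring

/-! ### Ratio induction -/

/-- **Ratio induction for a second-order recurrence.** Let `u (n+2) = s n u (n+1) - t n u n` for
`n ≥ N` with `t n ≥ 0`, and let `0 < λ ≤ Λ` satisfy `λ + t n/λ ≤ s n ≤ Λ + t n/Λ` for `n ≥ N`.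
If `u N > 0` and `λ u N ≤ u (N+1) ≤ Λ u N`, then for every `n ≥ N`:
`u n > 0` and `λ u n ≤ u (n+1) ≤ Λ u n`.
[cite: Zudilin2003Catalan, Sect. 1, the display after Theorem 1 ("application of Poincaré's theorem … yields the limit relations") — generic second-order-recurrence tool of that application] -/
theorem ratio_bounds_of_recurrence (u s t : ℕ → ℝ) {lam Lam : ℝ} (N : ℕ)
    (hrec : ∀ n, N ≤ n → u (n + 2) = s n * u (n + 1) - t n * u n)
    (ht : ∀ n, N ≤ n → 0 ≤ t n) (hlam : 0 < lam) (hLam : lam ≤ Lam)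
    (hlow : ∀ n, N ≤ n → lam + t n / lam ≤ s n) (hup : ∀ n, N ≤ n → s n ≤ Lam + t n / Lam)
    (h0 : 0 < u N) (h1 : lam * u N ≤ u (N + 1)) (h1' : u (N + 1) ≤ Lam * u N) :
    ∀ n, N ≤ n → 0 < u n ∧ lam * u n ≤ u (n + 1) ∧ u (n + 1) ≤ Lam * u n := by
  have hLam0 : 0 < Lam := hlam.trans_le hLam
  refine Nat.le_induction ⟨h0, h1, h1'⟩ fun n hn ih => ?_
  obtain ⟨hpos, hlo, hhi⟩ := ih
  have hpos1 : 0 < u (n + 1) := (mul_pos hlam hpos).trans_le hlo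
  refine ⟨hpos1, ?_, ?_⟩
  · -- `u (n+2) = s u(n+1) - t u n ≥ (s - t/λ) u (n+1) ≥ λ u (n+1)`
    rw [show n + 1 + 1 = n + 2 by ring, hrec n hn]
    have hun : u n ≤ u (n + 1) / lam := by rw [le_div_iff₀ hlam]; linarith
    have h2 : t n * u n ≤ t n * (u (n + 1) / lam) := mul_le_mul_of_nonneg_left hun (ht n hn)
    have h3 : (lam + t n / lam) * u (n + 1) ≤ s n * u (n + 1) :=
      mul_le_mul_of_nonneg_right (hlow n hn) hpos1.le
    have e : (lam + t n / lam) * u (n + 1) = lam * u (n + 1) + t n * (u (n + 1) / lam) := by ring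
    linarith
  · -- `u (n+2) = s u(n+1) - t u n ≤ (s - t/Λ) u (n+1) ≤ Λ u (n+1)`
    rw [show n + 1 + 1 = n + 2 by ring, hrec n hn]
    have hun : u (n + 1) / Lam ≤ u n := by rw [div_le_iff₀ hLam0]; linarith
    have h2 : t n * (u (n + 1) / Lam) ≤ t n * u n := mul_le_mul_of_nonneg_left hun (ht n hn)
    have h3 : s n * u (n + 1) ≤ (Lam + t n / Lam) * u (n + 1) :=
      mul_le_mul_of_nonneg_right (hup n hn) hpos1.le
    have e : (Lam + t n / Lam) * u (n + 1) = Lam * u (n + 1) + t n * (u (n + 1) / Lam) := by ring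
    linarith

/-! ### From ratio bounds to exponential bounds -/

/-- A lower ratio bound `λ u n ≤ u (n+1)` (`n ≥ N`, `λ ≥ 0`) gives `u N λ^{n-N} ≤ u n`, stated as
`u N λ^m ≤ u (N + m)`.
[cite: Zudilin2003Catalan, Sect. 1, the display after Theorem 1 ("application of Poincaré's theorem … yields the limit relations") — generic second-order-recurrence tool of that application] -/
theorem le_of_ratio_lower (u : ℕ → ℝ) {lam : ℝ} (N : ℕ) (hlam : 0 ≤ lam)
    (h : ∀ n, N ≤ n → lam * u n ≤ u (n + 1)) : ∀ m : ℕ, u N * lam ^ m ≤ u (N + m) := by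
  intro m
  induction m with
  | zero => simp
  | succ m ih =>
    calc u N * lam ^ (m + 1) = lam * (u N * lam ^ m) := by ring
      _ ≤ lam * u (N + m) := mul_le_mul_of_nonneg_left ih hlam
      _ ≤ u (N + m + 1) := h (N + m) (Nat.le_add_right N m)
      _ = u (N + (m + 1)) := by rw [Nat.add_assoc]

/-- An upper ratio bound `u (n+1) ≤ Λ u n` (`n ≥ N`, `Λ ≥ 0`) gives `u (N + m) ≤ u N Λ^m`.
[cite: Zudilin2003Catalan, Sect. 1, the display after Theorem 1 ("application of Poincaré's theorem … yields the limit relations") — generic second-order-recurrence tool of that application] -/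
theorem le_of_ratio_upper (u : ℕ → ℝ) {Lam : ℝ} (N : ℕ) (hLam : 0 ≤ Lam)
    (h : ∀ n, N ≤ n → u (n + 1) ≤ Lam * u n) : ∀ m : ℕ, u (N + m) ≤ u N * Lam ^ m := by
  intro m
  induction m with
  | zero => simp
  | succ m ih =>
    calc u (N + (m + 1)) = u (N + m + 1) := by rw [Nat.add_assoc]
      _ ≤ Lam * u (N + m) := h (N + m) (Nat.le_add_right N m)
      _ ≤ Lam * (u N * Lam ^ m) := mul_le_mul_of_nonneg_left ih hLam
      _ = u N * Lam ^ (m + 1) := by ring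

/-- **Certificate field `growth_lower` from a ratio bound.** If `u N > 0` and `λ u n ≤ u (n+1)`
for `n ≥ N` with `λ > 0`, then for every `Q < log λ`: `e^{Q n} ≤ u n` for all large `n`.
[cite: Zudilin2003Catalan, Sect. 1, the display after Theorem 1 ("application of Poincaré's theorem … yields the limit relations") — generic second-order-recurrence tool of that application] -/
theorem eventually_exp_le_of_ratio (u : ℕ → ℝ) {lam : ℝ} (N : ℕ) (hlam : 0 < lam) (h0 : 0 < u N)
    (h : ∀ n, N ≤ n → lam * u n ≤ u (n + 1)) {Q : ℝ} (hQ : Q < Real.log lam) :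
    ∀ᶠ n : ℕ in atTop, Real.exp (Q * n) ≤ u n := by
  -- `u n ≥ u N λ^{-N} · λ^n = e^{c + n log λ}` with `c = log (u N) - N log λ`; and
  -- `Q n ≤ c + n log λ` for large `n` since `log λ - Q > 0`.
  have hgap : 0 < Real.log lam - Q := by linarith
  have hev : ∀ᶠ n : ℕ in atTop, (N : ℝ) * Real.log lam - Real.log (u N) ≤ (Real.log lam - Q) * n :=
    (tendsto_natCast_atTop_atTop.const_mul_atTop hgap).eventually_ge_atTop _
  filter_upwards [hev, eventually_ge_atTop N] with n hn hnN
  obtain ⟨m, rfl⟩ : ∃ m, n = N + m := ⟨n - N, by omega⟩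
  have h1 : u N * lam ^ m ≤ u (N + m) := le_of_ratio_lower u N hlam.le h m
  refine le_trans ?_ h1
  -- compare logarithms
  rw [← Real.exp_log (mul_pos h0 (pow_pos hlam m)), Real.exp_le_exp, Real.log_mul h0.ne'
    (pow_pos hlam m).ne', Real.log_pow]
  have h3 : ((N + m : ℕ) : ℝ) = N + m := by push_cast; ring
  rw [h3] at hn ⊢
  nlinarith

/-- **Certificate field `growth_upper` from a ratio bound.** If `u n > 0` and `u (n+1) ≤ Λ u n`
for `n ≥ N` with `Λ > 0`, then for every `Q' > log Λ`: `u n ≤ e^{Q' n}` for all large `n`.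
[cite: Zudilin2003Catalan, Sect. 1, the display after Theorem 1 ("application of Poincaré's theorem … yields the limit relations") — generic second-order-recurrence tool of that application] -/
theorem eventually_le_exp_of_ratio (u : ℕ → ℝ) {Lam : ℝ} (N : ℕ) (hLam : 0 < Lam) (h0 : 0 < u N)
    (h : ∀ n, N ≤ n → u (n + 1) ≤ Lam * u n) {Q' : ℝ} (hQ' : Real.log Lam < Q') :
    ∀ᶠ n : ℕ in atTop, u n ≤ Real.exp (Q' * n) := by
  have hgap : 0 < Q' - Real.log Lam := by linarith
  have hev : ∀ᶠ n : ℕ in atTop, Real.log (u N) - (N : ℝ) * Real.log Lam ≤ (Q' - Real.log Lam) * n :=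
    (tendsto_natCast_atTop_atTop.const_mul_atTop hgap).eventually_ge_atTop _
  filter_upwards [hev, eventually_ge_atTop N] with n hn hnN
  obtain ⟨m, rfl⟩ : ∃ m, n = N + m := ⟨n - N, by omega⟩
  have h1 : u (N + m) ≤ u N * Lam ^ m := le_of_ratio_upper u N hLam.le h m
  refine h1.trans ?_
  rw [← Real.exp_log (mul_pos h0 (pow_pos hLam m)), Real.exp_le_exp, Real.log_mul h0.ne'
    (pow_pos hLam m).ne', Real.log_pow]
  have h3 : ((N + m : ℕ) : ℝ) = N + m := by push_cast; ring
  rw [h3] at hn ⊢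
  nlinarith

/-! ### Ratio induction when `t n ≤ 0` (dominant root of `x² - s x + t` with `t < 0`) -/

/-- **Ratio induction, second order, `t n ≤ 0`** (recurrences `y (n+2) = s n y (n+1) + |t n| y n`
with both coefficients nonnegative, e.g. Zudilin's 2003 recursion for Catalan's constant whose
characteristic polynomial `x² - 11x - 1` has roots of opposite signs). Then the ratio map
`r ↦ s n - t n / r` is DECREASING, and the box `[λ, Λ]` (`0 < λ ≤ Λ`) is invariant as soon as
`λ ≤ s n - t n/Λ` and `s n - t n/λ ≤ Λ` for `n ≥ N`; with `u N > 0` and `λ u N ≤ u (N+1) ≤ Λ u N`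
one gets `u n > 0` and `λ u n ≤ u (n+1) ≤ Λ u n` for every `n ≥ N`.
[cite: Zudilin2003Catalan, Sect. 1, the display after Theorem 1 ("application of Poincaré's theorem … yields the limit relations") — generic second-order-recurrence tool of that application] -/
theorem ratio_bounds_of_recurrence_neg (u s t : ℕ → ℝ) {lam Lam : ℝ} (N : ℕ)
    (hrec : ∀ n, N ≤ n → u (n + 2) = s n * u (n + 1) - t n * u n)
    (ht : ∀ n, N ≤ n → t n ≤ 0) (hlam : 0 < lam) (hLam : lam ≤ Lam)
    (hlow : ∀ n, N ≤ n → lam ≤ s n - t n / Lam) (hup : ∀ n, N ≤ n → s n - t n / lam ≤ Lam)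
    (h0 : 0 < u N) (h1 : lam * u N ≤ u (N + 1)) (h1' : u (N + 1) ≤ Lam * u N) :
    ∀ n, N ≤ n → 0 < u n ∧ lam * u n ≤ u (n + 1) ∧ u (n + 1) ≤ Lam * u n := by
  have hLam0 : 0 < Lam := hlam.trans_le hLam
  refine Nat.le_induction ⟨h0, h1, h1'⟩ fun n hn ih => ?_
  obtain ⟨hpos, hlo, hhi⟩ := ih
  have hpos1 : 0 < u (n + 1) := (mul_pos hlam hpos).trans_le hlo
  have htn : 0 ≤ -t n := by linarith [ht n hn]
  refine ⟨hpos1, ?_, ?_⟩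
  · -- `u (n+2) = s u(n+1) + |t| u n ≥ s u(n+1) + |t| u(n+1)/Λ = (s - t/Λ) u(n+1) ≥ λ u(n+1)`
    rw [show n + 1 + 1 = n + 2 by ring, hrec n hn]
    have hun : u (n + 1) / Lam ≤ u n := by rw [div_le_iff₀ hLam0]; linarith
    have h2 : -t n * (u (n + 1) / Lam) ≤ -t n * u n := mul_le_mul_of_nonneg_left hun htn
    have h3 : (lam : ℝ) * u (n + 1) ≤ (s n - t n / Lam) * u (n + 1) :=
      mul_le_mul_of_nonneg_right (hlow n hn) hpos1.le
    have e : (s n - t n / Lam) * u (n + 1) = s n * u (n + 1) + -t n * (u (n + 1) / Lam) := by ring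
    linarith
  · -- `u (n+2) ≤ s u(n+1) + |t| u(n+1)/λ = (s - t/λ) u(n+1) ≤ Λ u(n+1)`
    rw [show n + 1 + 1 = n + 2 by ring, hrec n hn]
    have hun : u n ≤ u (n + 1) / lam := by rw [le_div_iff₀ hlam]; linarith
    have h2 : -t n * u n ≤ -t n * (u (n + 1) / lam) := mul_le_mul_of_nonneg_left hun htn
    have h3 : (s n - t n / lam) * u (n + 1) ≤ Lam * u (n + 1) :=
      mul_le_mul_of_nonneg_right (hup n hn) hpos1.le
    have e : (s n - t n / lam) * u (n + 1) = s n * u (n + 1) + -t n * (u (n + 1) / lam) := by ring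
    linarith

end Literature.NumberTheory.Irrationality.Zudilin2003

end

/-! ## (2/6) `Zudilin2003Growth.lean` -/

section

open Filter Topology
open Literature.NumberTheory.Irrationality.Zudilin2003

namespace Literature.NumberTheory.Irrationality.Zudilin2003

namespace Zudilin2003Growth

/-- `uₙ` as a real sequence.
[cite: Zudilin2003Catalan, Sect. 1, the display after Theorem 1 ("application of Poincaré's theorem (see also [Zu1, Proposition 2]) yields the limit relations lim u_n^(1/n) = lim v_n^(1/n) = ((1+√5)/2)^5 = exp(2.40605912…), lim |u_n G − v_n|^(1/n) = |(1−√5)/2|^5")] -/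
def uR (n : ℕ) : ℝ := (u n : ℝ)

/-- Leading coefficient `L_m = (2m+3)²(2m+4)² p(m+1)` of (2) at `n = m+1`.
[cite: Zudilin2003Catalan, Sect. 1, the display after Theorem 1 ("application of Poincaré's theorem (see also [Zu1, Proposition 2]) yields the limit relations lim u_n^(1/n) = lim v_n^(1/n) = ((1+√5)/2)^5 = exp(2.40605912…), lim |u_n G − v_n|^(1/n) = |(1−√5)/2|^5")] -/
def LC (m : ℕ) : ℝ := (2 * (m : ℝ) + 3) ^ 2 * (2 * (m : ℝ) + 4) ^ 2 * p ((m : ℝ) + 1)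

/-- Numerator `(2m+1)²(2m+2)² p(m+2)` of the second coefficient.
[cite: Zudilin2003Catalan, Sect. 1, the display after Theorem 1 ("application of Poincaré's theorem (see also [Zu1, Proposition 2]) yields the limit relations lim u_n^(1/n) = lim v_n^(1/n) = ((1+√5)/2)^5 = exp(2.40605912…), lim |u_n G − v_n|^(1/n) = |(1−√5)/2|^5")] -/
def TC (m : ℕ) : ℝ := (2 * (m : ℝ) + 1) ^ 2 * (2 * (m : ℝ) + 2) ^ 2 * p ((m : ℝ) + 2)

/-- `s_m = q(m+1)/L_m`.
[cite: Zudilin2003Catalan, Sect. 1, the display after Theorem 1 ("application of Poincaré's theorem (see also [Zu1, Proposition 2]) yields the limit relations lim u_n^(1/n) = lim v_n^(1/n) = ((1+√5)/2)^5 = exp(2.40605912…), lim |u_n G − v_n|^(1/n) = |(1−√5)/2|^5")] -/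
def sC (m : ℕ) : ℝ := q ((m : ℝ) + 1) / LC m

/-- `t_m = -(2m+1)²(2m+2)² p(m+2)/L_m` (nonpositive).
[cite: Zudilin2003Catalan, Sect. 1, the display after Theorem 1 ("application of Poincaré's theorem (see also [Zu1, Proposition 2]) yields the limit relations lim u_n^(1/n) = lim v_n^(1/n) = ((1+√5)/2)^5 = exp(2.40605912…), lim |u_n G − v_n|^(1/n) = |(1−√5)/2|^5")] -/
def tC (m : ℕ) : ℝ := -TC m / LC m

/-- `p(m+1) = 20m² + 32m + 13`.
[cite: Zudilin2003Catalan, Sect. 1, the display after Theorem 1 ("application of Poincaré's theorem (see also [Zu1, Proposition 2]) yields the limit relations lim u_n^(1/n) = lim v_n^(1/n) = ((1+√5)/2)^5 = exp(2.40605912…), lim |u_n G − v_n|^(1/n) = |(1−√5)/2|^5")] -/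
theorem p_add_one (m : ℕ) : p ((m : ℝ) + 1) = 20 * (m : ℝ) ^ 2 + 32 * m + 13 := by
  unfold p; ring

/-- `p(m+2) = 20m² + 72m + 65`.
[cite: Zudilin2003Catalan, Sect. 1, the display after Theorem 1 ("application of Poincaré's theorem (see also [Zu1, Proposition 2]) yields the limit relations lim u_n^(1/n) = lim v_n^(1/n) = ((1+√5)/2)^5 = exp(2.40605912…), lim |u_n G − v_n|^(1/n) = |(1−√5)/2|^5")] -/
theorem p_add_two (m : ℕ) : p ((m : ℝ) + 2) = 20 * (m : ℝ) ^ 2 + 72 * m + 65 := by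
  unfold p; ring

/-- `L_m > 0`.
[cite: Zudilin2003Catalan, Sect. 1, the display after Theorem 1 ("application of Poincaré's theorem (see also [Zu1, Proposition 2]) yields the limit relations lim u_n^(1/n) = lim v_n^(1/n) = ((1+√5)/2)^5 = exp(2.40605912…), lim |u_n G − v_n|^(1/n) = |(1−√5)/2|^5")] -/
theorem LC_pos (m : ℕ) : 0 < LC m := by
  unfold LC; rw [p_add_one]; positivity

/-- `Tn_m ≥ 0`.
[cite: Zudilin2003Catalan, Sect. 1, the display after Theorem 1 ("application of Poincaré's theorem (see also [Zu1, Proposition 2]) yields the limit relations lim u_n^(1/n) = lim v_n^(1/n) = ((1+√5)/2)^5 = exp(2.40605912…), lim |u_n G − v_n|^(1/n) = |(1−√5)/2|^5")] -/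
theorem TC_nonneg (m : ℕ) : 0 ≤ TC m := by
  unfold TC; rw [p_add_two]; positivity

/-- `t_m ≤ 0`.
[cite: Zudilin2003Catalan, Sect. 1, the display after Theorem 1 ("application of Poincaré's theorem (see also [Zu1, Proposition 2]) yields the limit relations lim u_n^(1/n) = lim v_n^(1/n) = ((1+√5)/2)^5 = exp(2.40605912…), lim |u_n G − v_n|^(1/n) = |(1−√5)/2|^5")] -/
theorem tC_nonpos (m : ℕ) : tC m ≤ 0 := by
  unfold tC; rw [neg_div]
  exact neg_nonpos.2 (div_nonneg (TC_nonneg m) (LC_pos m).le)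

/-- **The recursion (2) in solved form over `ℝ`**: `u_{m+2} = s_m u_{m+1} - t_m u_m`.
[cite: Zudilin2003Catalan, Sect. 1, the display after Theorem 1 ("application of Poincaré's theorem (see also [Zu1, Proposition 2]) yields the limit relations lim u_n^(1/n) = lim v_n^(1/n) = ((1+√5)/2)^5 = exp(2.40605912…), lim |u_n G − v_n|^(1/n) = |(1−√5)/2|^5")] -/
theorem uR_rec (m : ℕ) : uR (m + 2) = sC m * uR (m + 1) - tC m * uR m := by
  have hL : LC m ≠ 0 := (LC_pos m).ne'
  have h : u (m + 2) = step m (u m) (u (m + 1)) := by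
    unfold u; exact sol_step _ _ m
  have h' := congrArg (fun x : ℚ => (x : ℝ)) h
  simp only [step, p, q] at h'
  push_cast at h'
  unfold uR sC tC TC LC
  simp only [p, q] at hL ⊢
  rw [h']
  field_simp
  ring

/-! ### Initial data -/

/-- `u₂ = 649/64`.
[cite: Zudilin2003Catalan, Sect. 1, the display after Theorem 1 ("application of Poincaré's theorem (see also [Zu1, Proposition 2]) yields the limit relations lim u_n^(1/n) = lim v_n^(1/n) = ((1+√5)/2)^5 = exp(2.40605912…), lim |u_n G − v_n|^(1/n) = |(1−√5)/2|^5")] -/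
theorem u_two : u 2 = 649 / 64 := by
  have h : u 2 = step 0 (u 0) (u 1) := by unfold u; exact sol_step _ _ 0
  rw [h]; unfold u; rw [sol_zero, sol_one]; norm_num [step, p, q]

/-- `u₃ = 19471/256`.
[cite: Zudilin2003Catalan, Sect. 1, the display after Theorem 1 ("application of Poincaré's theorem (see also [Zu1, Proposition 2]) yields the limit relations lim u_n^(1/n) = lim v_n^(1/n) = ((1+√5)/2)^5 = exp(2.40605912…), lim |u_n G − v_n|^(1/n) = |(1−√5)/2|^5")] -/
theorem u_three : u 3 = 19471 / 256 := by
  have h : u 3 = step 1 (u 1) (u 2) := by unfold u; exact sol_step _ _ 1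
  rw [h, u_two]; unfold u; rw [sol_one]; norm_num [step, p, q]

/-! ### Corner inequalities on the box `[15/2, 557/50]`, from `m = 2` on -/

/-- Lower corner: `15/2 ≤ s_m - t_m/(557/50)` for `m ≥ 2` (cleared: degree-6 polynomial in
`k = m - 2` with nonnegative coefficients).
[cite: Zudilin2003Catalan, Sect. 1, the display after Theorem 1 ("application of Poincaré's theorem (see also [Zu1, Proposition 2]) yields the limit relations lim u_n^(1/n) = lim v_n^(1/n) = ((1+√5)/2)^5 = exp(2.40605912…), lim |u_n G − v_n|^(1/n) = |(1−√5)/2|^5")] -/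
theorem corner_low (m : ℕ) (hm : 2 ≤ m) : (15 / 2 : ℝ) ≤ sC m - tC m / (557 / 50) := by
  obtain ⟨k, rfl⟩ : ∃ k, m = k + 2 := ⟨m - 2, by omega⟩
  have hL := LC_pos (k + 2)
  have e : sC (k + 2) - tC (k + 2) / (557 / 50) =
      (557 * q (((k + 2 : ℕ) : ℝ) + 1) + 50 * TC (k + 2)) / (557 * LC (k + 2)) := by
    unfold sC tC; field_simp; ring
  have hP : 100 * (557 * q (((k + 2 : ℕ) : ℝ) + 1) + 50 * TC (k + 2)) -
      100 * ((15 / 2) * (557 * LC (k + 2))) =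
      50 * (468806062 + 1203819856 * (k : ℝ) + 1184875996 * (k : ℝ) ^ 2 + 590373616 * (k : ℝ) ^ 3 +
      159547456 * (k : ℝ) ^ 4 + 22376128 * (k : ℝ) ^ 5 + 1279680 * (k : ℝ) ^ 6) := by
    unfold TC LC; simp only [p, q]; push_cast; ring
  rw [e, le_div_iff₀ (by positivity)]
  have h0 : (0 : ℝ) ≤ 100 * (557 * q (((k + 2 : ℕ) : ℝ) + 1) + 50 * TC (k + 2)) -
      100 * ((15 / 2) * (557 * LC (k + 2))) := by rw [hP]; positivity
  linarith

/-- Upper corner: `s_m - t_m/(15/2) ≤ 557/50` for `m ≥ 2`.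
[cite: Zudilin2003Catalan, Sect. 1, the display after Theorem 1 ("application of Poincaré's theorem (see also [Zu1, Proposition 2]) yields the limit relations lim u_n^(1/n) = lim v_n^(1/n) = ((1+√5)/2)^5 = exp(2.40605912…), lim |u_n G − v_n|^(1/n) = |(1−√5)/2|^5")] -/
theorem corner_up (m : ℕ) (hm : 2 ≤ m) : sC m - tC m / (15 / 2) ≤ (557 / 50 : ℝ) := by
  obtain ⟨k, rfl⟩ : ∃ k, m = k + 2 := ⟨m - 2, by omega⟩
  have hL := LC_pos (k + 2)
  have e : sC (k + 2) - tC (k + 2) / (15 / 2) =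
      (15 * q (((k + 2 : ℕ) : ℝ) + 1) + 2 * TC (k + 2)) / (15 * LC (k + 2)) := by
    unfold sC tC; field_simp; ring
  have hP : 100 * ((557 / 50) * (15 * LC (k + 2))) -
      100 * (15 * q (((k + 2 : ℕ) : ℝ) + 1) + 2 * TC (k + 2)) =
      2 * (1019998710 + 1571586960 * (k : ℝ) + 964647380 * (k : ℝ) ^ 2 + 294897680 * (k : ℝ) ^ 3 +
      44927360 * (k : ℝ) ^ 4 + 2736960 * (k : ℝ) ^ 5 + 1600 * (k : ℝ) ^ 6) := by
    unfold TC LC; simp only [p, q]; push_cast; ring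
  rw [e, div_le_iff₀ (by positivity)]
  have h0 : (0 : ℝ) ≤ 100 * ((557 / 50) * (15 * LC (k + 2))) -
      100 * (15 * q (((k + 2 : ℕ) : ℝ) + 1) + 2 * TC (k + 2)) := by rw [hP]; positivity
  linarith

/-! ### The certified bracket -/

/-- **Kernel-certified ratio bracket for Zudilin's Catalan denominators.** For every `n ≥ 2`:
`uₙ > 0` and `(15/2) uₙ ≤ u_{n+1} ≤ (557/50) uₙ`.
[cite: Zudilin2003Catalan, Sect. 1, the display after Theorem 1 ("application of Poincaré's theorem (see also [Zu1, Proposition 2]) yields the limit relations lim u_n^(1/n) = lim v_n^(1/n) = ((1+√5)/2)^5 = exp(2.40605912…), lim |u_n G − v_n|^(1/n) = |(1−√5)/2|^5")] -/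
theorem ratio_bounds :
    ∀ n, 2 ≤ n → 0 < uR n ∧ 15 / 2 * uR n ≤ uR (n + 1) ∧ uR (n + 1) ≤ 557 / 50 * uR n := by
  refine ratio_bounds_of_recurrence_neg uR sC tC 2 (fun m _ => uR_rec m) (fun m _ => tC_nonpos m)
    (by norm_num) (by norm_num) (fun m hm => corner_low m hm) (fun m hm => corner_up m hm) ?_ ?_ ?_
  · unfold uR; rw [u_two]; norm_num
  · unfold uR; rw [u_two, u_three]; norm_num
  · unfold uR; rw [u_two, u_three]; norm_num

/-- **Explicit upper bound**: `u_{2+m} ≤ (649/64) · (557/50)^m`.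
[cite: Zudilin2003Catalan, Sect. 1, the display after Theorem 1 ("application of Poincaré's theorem (see also [Zu1, Proposition 2]) yields the limit relations lim u_n^(1/n) = lim v_n^(1/n) = ((1+√5)/2)^5 = exp(2.40605912…), lim |u_n G − v_n|^(1/n) = |(1−√5)/2|^5")] -/
theorem u_le (m : ℕ) : (u (2 + m) : ℝ) ≤ 649 / 64 * (557 / 50) ^ m := by
  have h := le_of_ratio_upper uR 2 (by norm_num : (0 : ℝ) ≤ 557 / 50)
    (fun n hn => (ratio_bounds n hn).2.2) m
  have h2 : uR 2 = 649 / 64 := by unfold uR; rw [u_two]; norm_num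
  rw [h2] at h
  exact h

/-- **Explicit lower bound**: `(649/64) · (15/2)^m ≤ u_{2+m}`.
[cite: Zudilin2003Catalan, Sect. 1, the display after Theorem 1 ("application of Poincaré's theorem (see also [Zu1, Proposition 2]) yields the limit relations lim u_n^(1/n) = lim v_n^(1/n) = ((1+√5)/2)^5 = exp(2.40605912…), lim |u_n G − v_n|^(1/n) = |(1−√5)/2|^5")] -/
theorem le_u (m : ℕ) : 649 / 64 * (15 / 2 : ℝ) ^ m ≤ (u (2 + m) : ℝ) := by
  have h := le_of_ratio_lower uR 2 (by norm_num : (0 : ℝ) ≤ 15 / 2)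
    (fun n hn => (ratio_bounds n hn).2.1) m
  have h2 : uR 2 = 649 / 64 := by unfold uR; rw [u_two]; norm_num
  rw [h2] at h
  exact h

/-- **Growth exponent, upper**: for every `Q' > log (557/50)` (`= 2.4105…`; the paper's rate is
`log ((11+5√5)/2) = 2.40606…`), `uₙ ≤ e^{Q' n}` for all large `n`.
[cite: Zudilin2003Catalan, Sect. 1, the display after Theorem 1 ("application of Poincaré's theorem (see also [Zu1, Proposition 2]) yields the limit relations lim u_n^(1/n) = lim v_n^(1/n) = ((1+√5)/2)^5 = exp(2.40605912…), lim |u_n G − v_n|^(1/n) = |(1−√5)/2|^5")] -/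
theorem eventually_u_le_exp {Q' : ℝ} (hQ' : Real.log (557 / 50) < Q') :
    ∀ᶠ n : ℕ in atTop, (u n : ℝ) ≤ Real.exp (Q' * n) := by
  have h2 : (0 : ℝ) < uR 2 := by unfold uR; rw [u_two]; norm_num
  exact eventually_le_exp_of_ratio uR 2 (by norm_num : (0 : ℝ) < 557 / 50) h2
    (fun n hn => (ratio_bounds n hn).2.2) hQ'

/-- **Growth exponent, lower**: for every `Q < log (15/2)`, `e^{Q n} ≤ uₙ` for all large `n`.
[cite: Zudilin2003Catalan, Sect. 1, the display after Theorem 1 ("application of Poincaré's theorem (see also [Zu1, Proposition 2]) yields the limit relations lim u_n^(1/n) = lim v_n^(1/n) = ((1+√5)/2)^5 = exp(2.40605912…), lim |u_n G − v_n|^(1/n) = |(1−√5)/2|^5")] -/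
theorem eventually_exp_le_u {Q : ℝ} (hQ : Q < Real.log (15 / 2)) :
    ∀ᶠ n : ℕ in atTop, Real.exp (Q * n) ≤ (u n : ℝ) := by
  have h2 : (0 : ℝ) < uR 2 := by unfold uR; rw [u_two]; norm_num
  exact eventually_exp_le_of_ratio uR 2 (by norm_num : (0 : ℝ) < 15 / 2) h2
    (fun n hn => (ratio_bounds n hn).2.1) hQ

end Zudilin2003Growth

end Literature.NumberTheory.Irrationality.Zudilin2003

end

/-! ## (3/6) `Zudilin2003Casoratian.lean` -/

section

open Filter Topology Finset
open Literature.NumberTheory.Irrationality.Zudilin2003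
open Literature.NumberTheory.Transcendental

namespace Literature.NumberTheory.Irrationality.Zudilin2003

namespace Zudilin2003Growth

/-! ### The second solution -/

/-- `vₙ` as a real sequence.
[cite: Zudilin2003Catalan, Sect. 1, the display after Theorem 1 ("application of Poincaré's theorem (see also [Zu1, Proposition 2]) yields the limit relations lim u_n^(1/n) = lim v_n^(1/n) = ((1+√5)/2)^5 = exp(2.40605912…), lim |u_n G − v_n|^(1/n) = |(1−√5)/2|^5")] -/
def vR (n : ℕ) : ℝ := (v n : ℝ)

/-- **The recursion for `v` over `ℝ`**: `v_{m+2} = s_m v_{m+1} - t_m v_m`.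
[cite: Zudilin2003Catalan, Sect. 1, the display after Theorem 1 ("application of Poincaré's theorem (see also [Zu1, Proposition 2]) yields the limit relations lim u_n^(1/n) = lim v_n^(1/n) = ((1+√5)/2)^5 = exp(2.40605912…), lim |u_n G − v_n|^(1/n) = |(1−√5)/2|^5")] -/
theorem vR_rec (m : ℕ) : vR (m + 2) = sC m * vR (m + 1) - tC m * vR m := by
  have hL : LC m ≠ 0 := (LC_pos m).ne'
  have h : v (m + 2) = step m (v m) (v (m + 1)) := by
    unfold v; exact sol_step _ _ m
  have h' := congrArg (fun x : ℚ => (x : ℝ)) h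
  simp only [step, p, q] at h'
  push_cast at h'
  unfold vR sC tC TC LC
  simp only [p, q] at hL ⊢
  rw [h']
  field_simp
  ring

/-! ### The coefficient `t_m ∈ [-1, 0)` -/

/-- `TC_m > 0` (so `t_m < 0`).
[cite: Zudilin2003Catalan, Sect. 1, the display after Theorem 1 ("application of Poincaré's theorem (see also [Zu1, Proposition 2]) yields the limit relations lim u_n^(1/n) = lim v_n^(1/n) = ((1+√5)/2)^5 = exp(2.40605912…), lim |u_n G − v_n|^(1/n) = |(1−√5)/2|^5")] -/
theorem TC_pos (m : ℕ) : 0 < TC m := by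
  unfold TC; rw [p_add_two]; positivity

/-- `t_m ≠ 0`.
[cite: Zudilin2003Catalan, Sect. 1, the display after Theorem 1 ("application of Poincaré's theorem (see also [Zu1, Proposition 2]) yields the limit relations lim u_n^(1/n) = lim v_n^(1/n) = ((1+√5)/2)^5 = exp(2.40605912…), lim |u_n G − v_n|^(1/n) = |(1−√5)/2|^5")] -/
theorem tC_ne_zero (m : ℕ) : tC m ≠ 0 := by
  unfold tC
  exact div_ne_zero (neg_ne_zero.2 (TC_pos m).ne') (LC_pos m).ne'

/-- `|t_m| ≤ 1`: the cleared inequality `TC_m ≤ LC_m` is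
`1612 + 7128m + 12240m² + 10176m³ + 4096m⁴ + 640m⁵ ≥ 0`.
[cite: Zudilin2003Catalan, Sect. 1, the display after Theorem 1 ("application of Poincaré's theorem (see also [Zu1, Proposition 2]) yields the limit relations lim u_n^(1/n) = lim v_n^(1/n) = ((1+√5)/2)^5 = exp(2.40605912…), lim |u_n G − v_n|^(1/n) = |(1−√5)/2|^5")] -/
theorem abs_tC_le_one (m : ℕ) : |tC m| ≤ 1 := by
  have hL := LC_pos m
  have hT := TC_pos m
  have hdiff : LC m - TC m = 1612 + 7128 * (m : ℝ) + 12240 * (m : ℝ) ^ 2 + 10176 * (m : ℝ) ^ 3 +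
      4096 * (m : ℝ) ^ 4 + 640 * (m : ℝ) ^ 5 := by
    unfold LC TC; simp only [p]; ring
  have hle : TC m ≤ LC m := by
    have : (0 : ℝ) ≤ LC m - TC m := by rw [hdiff]; positivity
    linarith
  unfold tC
  rw [neg_div, abs_neg, abs_div, abs_of_pos hT, abs_of_pos hL, div_le_one hL]
  exact hle

/-! ### The Casoratian in closed form -/

/-- **Abel's formula for Zudilin's Catalan recursion**:
`uₙ v_{n+1} - u_{n+1} vₙ = (∏_{i<n} tᵢ) · 13/8`.
[cite: Zudilin2003Catalan, Sect. 1, the display after Theorem 1 ("application of Poincaré's theorem (see also [Zu1, Proposition 2]) yields the limit relations lim u_n^(1/n) = lim v_n^(1/n) = ((1+√5)/2)^5 = exp(2.40605912…), lim |u_n G − v_n|^(1/n) = |(1−√5)/2|^5")] -/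
theorem casoratian_eq (n : ℕ) :
    uR n * vR (n + 1) - uR (n + 1) * vR n = (∏ i ∈ range n, tC i) * (13 / 8) := by
  have h := casoratian_eq_prod_mul uR vR sC tC 0 (fun m _ => uR_rec m) (fun m _ => vR_rec m) n
    (Nat.zero_le n)
  rw [h, range_eq_Ico]
  congr 1
  unfold uR vR u v
  rw [sol_zero, sol_one, sol_zero, sol_one]
  norm_num

/-- **Non-vanishing**: `uₙ v_{n+1} ≠ u_{n+1} vₙ` for every `n` (consecutive approximants are distinct).
[cite: Zudilin2003Catalan, Sect. 1, the display after Theorem 1 ("application of Poincaré's theorem (see also [Zu1, Proposition 2]) yields the limit relations lim u_n^(1/n) = lim v_n^(1/n) = ((1+√5)/2)^5 = exp(2.40605912…), lim |u_n G − v_n|^(1/n) = |(1−√5)/2|^5")] -/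
theorem casoratian_ne_zero (n : ℕ) : uR n * vR (n + 1) - uR (n + 1) * vR n ≠ 0 := by
  rw [casoratian_eq]
  exact mul_ne_zero (prod_ne_zero_iff.2 fun i _ => tC_ne_zero i) (by norm_num)

/-- **Casoratian bound**: `|uₙ v_{n+1} - u_{n+1} vₙ| ≤ 13/8` for every `n`.
[cite: Zudilin2003Catalan, Sect. 1, the display after Theorem 1 ("application of Poincaré's theorem (see also [Zu1, Proposition 2]) yields the limit relations lim u_n^(1/n) = lim v_n^(1/n) = ((1+√5)/2)^5 = exp(2.40605912…), lim |u_n G − v_n|^(1/n) = |(1−√5)/2|^5")] -/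
theorem abs_casoratian_le (n : ℕ) : |uR n * vR (n + 1) - uR (n + 1) * vR n| ≤ 13 / 8 := by
  rw [casoratian_eq, abs_mul, abs_prod, abs_of_pos (by norm_num : (0 : ℝ) < 13 / 8)]
  have h : ∏ i ∈ range n, |tC i| ≤ 1 := by
    calc ∏ i ∈ range n, |tC i| ≤ ∏ i ∈ range n, (1 : ℝ) :=
          prod_le_prod (fun i _ => abs_nonneg _) fun i _ => abs_tC_le_one i
      _ = 1 := by simp
  nlinarith [prod_nonneg fun i (_ : i ∈ range n) => abs_nonneg (tC i)]

/-! ### Convergence of the approximants `vₙ/uₙ` -/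

/-- **One step, explicit geometric bound**: for every `m`,
`|v_{3+m}/u_{3+m} - v_{2+m}/u_{2+m}| ≤ K θ^m` with `K = (13/8)/((649/64)²·(15/2))`, `θ = 4/225`.
[cite: Zudilin2003Catalan, Sect. 1, the display after Theorem 1 ("application of Poincaré's theorem (see also [Zu1, Proposition 2]) yields the limit relations lim u_n^(1/n) = lim v_n^(1/n) = ((1+√5)/2)^5 = exp(2.40605912…), lim |u_n G − v_n|^(1/n) = |(1−√5)/2|^5")] -/
theorem abs_ratio_step_le (m : ℕ) :
    |vR (2 + m + 1) / uR (2 + m + 1) - vR (2 + m) / uR (2 + m)| ≤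
      13 / 8 / ((649 / 64) ^ 2 * (15 / 2)) * (4 / 225) ^ m := by
  have hn : 2 ≤ 2 + m := by omega
  have hu0 : 0 < uR (2 + m) := (ratio_bounds (2 + m) hn).1
  have hu1 : 0 < uR (2 + m + 1) := (ratio_bounds (2 + m + 1) (by omega)).1
  have hid : vR (2 + m + 1) / uR (2 + m + 1) - vR (2 + m) / uR (2 + m) =
      (uR (2 + m) * vR (2 + m + 1) - uR (2 + m + 1) * vR (2 + m)) / (uR (2 + m) * uR (2 + m + 1)) := by
    field_simp
  rw [hid, abs_div, abs_of_pos (mul_pos hu0 hu1)]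
  have hW := abs_casoratian_le (2 + m)
  -- denominators: `u (2+m) ≥ (649/64)(15/2)^m`, `u (2+m+1) ≥ (649/64)(15/2)^(m+1)`
  have hq0 : 649 / 64 * (15 / 2 : ℝ) ^ m ≤ uR (2 + m) := le_u m
  have hq1 : 649 / 64 * (15 / 2 : ℝ) ^ (m + 1) ≤ uR (2 + m + 1) := by
    have h := le_u (m + 1)
    rwa [show 2 + (m + 1) = 2 + m + 1 by ring] at h
  have hpos0 : (0 : ℝ) < 649 / 64 * (15 / 2) ^ m := by positivity
  have hpos1 : (0 : ℝ) < 649 / 64 * (15 / 2) ^ (m + 1) := by positivity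
  have hden : 649 / 64 * (15 / 2 : ℝ) ^ m * (649 / 64 * (15 / 2) ^ (m + 1)) ≤
      uR (2 + m) * uR (2 + m + 1) := mul_le_mul hq0 hq1 hpos1.le hu0.le
  calc |uR (2 + m) * vR (2 + m + 1) - uR (2 + m + 1) * vR (2 + m)| / (uR (2 + m) * uR (2 + m + 1))
      ≤ (13 / 8) / (649 / 64 * (15 / 2 : ℝ) ^ m * (649 / 64 * (15 / 2) ^ (m + 1))) := by
        gcongr
    _ = 13 / 8 / ((649 / 64) ^ 2 * (15 / 2)) * (4 / 225) ^ m := by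
        have hX : (0 : ℝ) < (15 / 2) ^ m := by positivity
        have e1 : (4 / 225 : ℝ) ^ m = (((15 / 2 : ℝ) ^ m)⁻¹) ^ 2 := by
          rw [show (4 / 225 : ℝ) = ((15 / 2)⁻¹) ^ 2 by norm_num, ← pow_mul, Nat.mul_comm 2 m,
            pow_mul, inv_pow]
        rw [e1, pow_succ]
        field_simp

/-- **The approximants converge geometrically**: there is `L` with `vₙ/uₙ → L` and
`|v_{2+m}/u_{2+m} - L| ≤ K θ^m/(1 - θ)` for every `m`.
[cite: Zudilin2003Catalan, Sect. 1, the display after Theorem 1 ("application of Poincaré's theorem (see also [Zu1, Proposition 2]) yields the limit relations lim u_n^(1/n) = lim v_n^(1/n) = ((1+√5)/2)^5 = exp(2.40605912…), lim |u_n G − v_n|^(1/n) = |(1−√5)/2|^5")] -/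
theorem exists_limit :
    ∃ L : ℝ, Tendsto (fun n : ℕ => vR n / uR n) atTop (𝓝 L) ∧
      ∀ m : ℕ, |vR (2 + m) / uR (2 + m) - L| ≤
        13 / 8 / ((649 / 64) ^ 2 * (15 / 2)) * (4 / 225) ^ m / (1 - 4 / 225) := by
  set f : ℕ → ℝ := fun m => vR (2 + m) / uR (2 + m) with hf
  have hθ : (4 / 225 : ℝ) < 1 := by norm_num
  have hstep : ∀ m, dist (f m) (f (m + 1)) ≤ 13 / 8 / ((649 / 64) ^ 2 * (15 / 2)) * (4 / 225 : ℝ) ^ m := by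
    intro m
    rw [dist_comm, Real.dist_eq, hf]
    simp only
    rw [show 2 + (m + 1) = 2 + m + 1 by ring]
    exact abs_ratio_step_le m
  have hcauchy := cauchySeq_of_le_geometric _ _ hθ hstep
  obtain ⟨L, hL⟩ := cauchySeq_tendsto_of_complete hcauchy
  refine ⟨L, ?_, fun m => ?_⟩
  · have h2 : Tendsto (fun m : ℕ => vR (m + 2) / uR (m + 2)) atTop (𝓝 L) :=
      hL.congr fun m => by simp only [hf, add_comm]
    exact (tendsto_add_atTop_iff_nat 2).1 h2
  · have h := dist_le_of_le_geometric_of_tendsto _ _ hθ hstep hL m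
    rwa [Real.dist_eq] at h

/-- **Conditional approximation rate for Catalan's constant**: under the tree's named fact
`Zudilin2003.theorem1` (which contains `vₙ/uₙ → G`; NOT proved here), for every `m`:
`|G - v_{2+m}/u_{2+m}| ≤ K θ^m/(1 - θ)`.
[cite: Zudilin2003Catalan, Sect. 1, the display after Theorem 1 ("application of Poincaré's theorem (see also [Zu1, Proposition 2]) yields the limit relations lim u_n^(1/n) = lim v_n^(1/n) = ((1+√5)/2)^5 = exp(2.40605912…), lim |u_n G − v_n|^(1/n) = |(1−√5)/2|^5")] -/
theorem abs_sub_catalan_le_of_theorem1 (h : theorem1) (m : ℕ) :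
    |catalanConstant - vR (2 + m) / uR (2 + m)| ≤
      13 / 8 / ((649 / 64) ^ 2 * (15 / 2)) * (4 / 225) ^ m / (1 - 4 / 225) := by
  obtain ⟨L, hL, hbound⟩ := exists_limit
  have hlim : Tendsto (fun n : ℕ => vR n / uR n) atTop (𝓝 catalanConstant) := by
    refine h.2.congr fun n => ?_
    unfold vR uR; push_cast; rfl
  have hLG : L = catalanConstant := tendsto_nhds_unique hL hlim
  rw [← hLG, abs_sub_comm]
  exact hbound m

end Zudilin2003Growth

end Literature.NumberTheory.Irrationality.Zudilin2003

end

/-! ## (4/6) `Zudilin2003ExactRates.lean` -/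

section

open Filter Topology Finset Set
open Literature.NumberTheory.Irrationality.Zudilin2003
open Literature.Analysis.Asymptotics.PoincareRecurrence

namespace Literature.NumberTheory.Irrationality.Zudilin2003

namespace Zudilin2003Growth

/-! ### Limits of the coefficients -/

/-- `1/(m+1) → 0` along `ℕ`. [folklore] -/
private theorem tendsto_inv_succ : Tendsto (fun m : ℕ => (1 : ℝ) / ((m : ℝ) + 1)) atTop (𝓝 0) :=
  tendsto_one_div_add_atTop_nhds_zero_nat

/-- **`s_m → 11`** (`s_m = q(m+1)/((2m+3)²(2m+4)²p(m+1))`, leading coefficients `3520 = 11·320`).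
[cite: Zudilin2003Catalan, Sect. 1, the display after Theorem 1 ("application of Poincaré's theorem (see also [Zu1, Proposition 2]) yields the limit relations lim u_n^(1/n) = lim v_n^(1/n) = ((1+√5)/2)^5 = exp(2.40605912…), lim |u_n G − v_n|^(1/n) = |(1−√5)/2|^5")] -/
theorem tendsto_sC : Tendsto sC atTop (𝓝 11) := by
  set F : ℝ → ℝ := fun y => 3520 + 5632 * y + 2064 * y ^ 2 - 384 * y ^ 3 - 156 * y ^ 4 +
      16 * y ^ 5 + 7 * y ^ 6 with hF
  set G : ℝ → ℝ := fun y => (2 + y) ^ 2 * (2 + 2 * y) ^ 2 * (20 - 8 * y + y ^ 2) with hG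
  have hGpos : ∀ m : ℕ, 0 < G (1 / ((m : ℝ) + 1)) := by
    intro m
    have hm : (m : ℝ) + 1 ≠ 0 := by positivity
    have e : G (1 / ((m : ℝ) + 1)) = LC m / ((m : ℝ) + 1) ^ 6 := by
      rw [hG]; unfold LC; simp only [p]; field_simp; ring
    rw [e]; exact div_pos (LC_pos m) (by positivity)
  have hseq : ∀ m : ℕ, sC m = F (1 / ((m : ℝ) + 1)) / G (1 / ((m : ℝ) + 1)) := by
    intro m
    have hm : (m : ℝ) + 1 ≠ 0 := by positivity
    have hp : p ((m : ℝ) + 1) ≠ 0 := by rw [p_add_one]; positivity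
    have h3 : 2 * (m : ℝ) + 3 ≠ 0 := by positivity
    have h4 : 2 * (m : ℝ) + 4 ≠ 0 := by positivity
    rw [eq_div_iff (hGpos m).ne']
    unfold sC LC
    rw [hF, hG]
    simp only
    field_simp
    simp only [p, q]
    ring
  have hFc : Continuous F := by rw [hF]; fun_prop
  have hGc : Continuous G := by rw [hG]; fun_prop
  have hF0 : Tendsto (fun m : ℕ => F (1 / ((m : ℝ) + 1))) atTop (𝓝 (F 0)) :=
    (hFc.tendsto 0).comp tendsto_inv_succ
  have hG0 : Tendsto (fun m : ℕ => G (1 / ((m : ℝ) + 1))) atTop (𝓝 (G 0)) :=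
    (hGc.tendsto 0).comp tendsto_inv_succ
  have hG0ne : G 0 ≠ 0 := by rw [hG]; norm_num
  have hlim : F 0 / G 0 = 11 := by rw [hF, hG]; norm_num
  rw [← hlim]
  exact (hF0.div hG0 hG0ne).congr fun m => (hseq m).symm

/-- **`t_m → -1`** (`t_m = -(2m+1)²(2m+2)²p(m+2)/((2m+3)²(2m+4)²p(m+1))`).
[cite: Zudilin2003Catalan, Sect. 1, the display after Theorem 1 ("application of Poincaré's theorem (see also [Zu1, Proposition 2]) yields the limit relations lim u_n^(1/n) = lim v_n^(1/n) = ((1+√5)/2)^5 = exp(2.40605912…), lim |u_n G − v_n|^(1/n) = |(1−√5)/2|^5")] -/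
theorem tendsto_tC : Tendsto tC atTop (𝓝 (-1)) := by
  set F : ℝ → ℝ := fun y => -((2 - y) ^ 2 * 2 ^ 2 * (20 * (1 + y) ^ 2 - 8 * (1 + y) * y + y ^ 2))
    with hF
  set G : ℝ → ℝ := fun y => (2 + y) ^ 2 * (2 + 2 * y) ^ 2 * (20 - 8 * y + y ^ 2) with hG
  have hGpos : ∀ m : ℕ, 0 < G (1 / ((m : ℝ) + 1)) := by
    intro m
    have hm : (m : ℝ) + 1 ≠ 0 := by positivity
    have e : G (1 / ((m : ℝ) + 1)) = LC m / ((m : ℝ) + 1) ^ 6 := by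
      rw [hG]; unfold LC; simp only [p]; field_simp; ring
    rw [e]; exact div_pos (LC_pos m) (by positivity)
  have hteq : ∀ m : ℕ, tC m = F (1 / ((m : ℝ) + 1)) / G (1 / ((m : ℝ) + 1)) := by
    intro m
    have hm : (m : ℝ) + 1 ≠ 0 := by positivity
    have hp : p ((m : ℝ) + 1) ≠ 0 := by rw [p_add_one]; positivity
    have h3 : 2 * (m : ℝ) + 3 ≠ 0 := by positivity
    have h4 : 2 * (m : ℝ) + 4 ≠ 0 := by positivity
    rw [eq_div_iff (hGpos m).ne']
    unfold tC TC LC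
    rw [hF, hG]
    simp only
    field_simp
    simp only [p]
    ring
  have hFc : Continuous F := by rw [hF]; fun_prop
  have hGc : Continuous G := by rw [hG]; fun_prop
  have hF0 : Tendsto (fun m : ℕ => F (1 / ((m : ℝ) + 1))) atTop (𝓝 (F 0)) :=
    (hFc.tendsto 0).comp tendsto_inv_succ
  have hG0 : Tendsto (fun m : ℕ => G (1 / ((m : ℝ) + 1))) atTop (𝓝 (G 0)) :=
    (hGc.tendsto 0).comp tendsto_inv_succ
  have hG0ne : G 0 ≠ 0 := by rw [hG]; norm_num
  have hlim : F 0 / G 0 = -1 := by rw [hF, hG]; norm_num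
  rw [← hlim]
  exact (hF0.div hG0 hG0ne).congr fun m => (hteq m).symm

/-! ### The dominant root `((1+√5)/2)⁵ = (11+5√5)/2` -/

/-- `2 < √5`.
[cite: Zudilin2003Catalan, Sect. 1, the display after Theorem 1 ("application of Poincaré's theorem (see also [Zu1, Proposition 2]) yields the limit relations lim u_n^(1/n) = lim v_n^(1/n) = ((1+√5)/2)^5 = exp(2.40605912…), lim |u_n G − v_n|^(1/n) = |(1−√5)/2|^5")] -/
theorem two_lt_sqrt_five : (2 : ℝ) < Real.sqrt 5 := by
  rw [show (2 : ℝ) = Real.sqrt 4 by rw [show (4 : ℝ) = 2 ^ 2 by norm_num, Real.sqrt_sq (by norm_num)]]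
  exact Real.sqrt_lt_sqrt (by norm_num) (by norm_num)

/-- `((1+√5)/2)⁵ = (11+5√5)/2` and it solves `λ² = 11λ + 1`.
[cite: Zudilin2003Catalan, Sect. 1, the display after Theorem 1 ("application of Poincaré's theorem (see also [Zu1, Proposition 2]) yields the limit relations lim u_n^(1/n) = lim v_n^(1/n) = ((1+√5)/2)^5 = exp(2.40605912…), lim |u_n G − v_n|^(1/n) = |(1−√5)/2|^5")] -/
theorem golden_fifth :
    ((1 + Real.sqrt 5) / 2) ^ 5 = (11 + 5 * Real.sqrt 5) / 2 ∧
      ((11 + 5 * Real.sqrt 5) / 2) ^ 2 = 11 * ((11 + 5 * Real.sqrt 5) / 2) - (-1) := by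
  have hs : Real.sqrt 5 ^ 2 = 5 := Real.sq_sqrt (by norm_num)
  obtain ⟨hroot, hpow⟩ := charPoly_root (Real.sqrt 5) hs
  refine ⟨hpow, ?_⟩
  unfold charPoly at hroot
  linear_combination hroot

/-! ### Poincaré: the ratio limit for any solution bracketed below by `15/2` -/

/-- **Poincaré's theorem applied**: any real solution `w` of (2) in solved form with `wₙ > 0` and
`(15/2) wₙ ≤ w_{n+1}` for `n ≥ 2` has `w_{n+1}/wₙ → ((1+√5)/2)⁵` (contraction constant `|−1|/(15/2)² < 1`;
`(11+5√5)/2 ≥ 15/2`).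
[cite: Zudilin2003Catalan, Sect. 1, the display after Theorem 1 ("application of Poincaré's theorem (see also [Zu1, Proposition 2]) yields the limit relations lim u_n^(1/n) = lim v_n^(1/n) = ((1+√5)/2)^5 = exp(2.40605912…), lim |u_n G − v_n|^(1/n) = |(1−√5)/2|^5")] -/
theorem tendsto_ratio_of_bracket (w : ℕ → ℝ)
    (hrec : ∀ m, w (m + 2) = sC m * w (m + 1) - tC m * w m)
    (hbr : ∀ n, 2 ≤ n → 0 < w n ∧ 15 / 2 * w n ≤ w (n + 1)) :
    Tendsto (fun n => w (n + 1) / w n) atTop (𝓝 (((1 + Real.sqrt 5) / 2) ^ 5)) := by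
  obtain ⟨hpow, hchar⟩ := golden_fifth
  rw [hpow]
  refine tendsto_ratio_of_recurrence₂ w sC tC (L := 15 / 2) 2 (fun m _ => hrec m) tendsto_sC
    tendsto_tC (by norm_num) (fun n hn => (hbr n hn).1.ne') (fun n hn => ?_) hchar ?_ (by norm_num)
  · obtain ⟨hpos, hle⟩ := hbr n hn
    rwa [le_div_iff₀ hpos]
  · linarith [two_lt_sqrt_five]

/-- **Rate from ratio** for such a solution: `log wₙ / n → log ((1+√5)/2)⁵`.
[cite: Zudilin2003Catalan, Sect. 1, the display after Theorem 1 ("application of Poincaré's theorem (see also [Zu1, Proposition 2]) yields the limit relations lim u_n^(1/n) = lim v_n^(1/n) = ((1+√5)/2)^5 = exp(2.40605912…), lim |u_n G − v_n|^(1/n) = |(1−√5)/2|^5")] -/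
theorem tendsto_log_div_of_bracket (w : ℕ → ℝ)
    (hrec : ∀ m, w (m + 2) = sC m * w (m + 1) - tC m * w m)
    (hbr : ∀ n, 2 ≤ n → 0 < w n ∧ 15 / 2 * w n ≤ w (n + 1)) (hpos : ∀ n, 0 < w n) :
    Tendsto (fun n => Real.log (w n) / n) atTop (𝓝 (Real.log (((1 + Real.sqrt 5) / 2) ^ 5))) := by
  have hl0 : (0 : ℝ) < ((1 + Real.sqrt 5) / 2) ^ 5 := by
    have := two_lt_sqrt_five; positivity
  have h := tendsto_log_abs_div_of_tendsto_ratio w 2 (fun n hn => (hbr n hn).1.ne') hl0.ne'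
    (tendsto_ratio_of_bracket w hrec hbr)
  rw [abs_of_pos hl0] at h
  exact h.congr fun n => by rw [abs_of_pos (hpos n)]

/-! ### `uₙ` -/

/-- `uₙ > 0` for all `n` (tree: `u_pos_and_v_succ_pos`).
[cite: Zudilin2003Catalan, Sect. 1, the display after Theorem 1 ("application of Poincaré's theorem (see also [Zu1, Proposition 2]) yields the limit relations lim u_n^(1/n) = lim v_n^(1/n) = ((1+√5)/2)^5 = exp(2.40605912…), lim |u_n G − v_n|^(1/n) = |(1−√5)/2|^5")] -/
theorem uR_pos (n : ℕ) : 0 < uR n := by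
  unfold uR; exact_mod_cast (u_pos_and_v_succ_pos n).1

/-- **Exact ratio limit**: `u_{n+1}/uₙ → ((1+√5)/2)⁵`.
[cite: Zudilin2003Catalan, Sect. 1, the display after Theorem 1 ("application of Poincaré's theorem (see also [Zu1, Proposition 2]) yields the limit relations lim u_n^(1/n) = lim v_n^(1/n) = ((1+√5)/2)^5 = exp(2.40605912…), lim |u_n G − v_n|^(1/n) = |(1−√5)/2|^5")] -/
theorem tendsto_ratio_uR :
    Tendsto (fun n => uR (n + 1) / uR n) atTop (𝓝 (((1 + Real.sqrt 5) / 2) ^ 5)) :=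
  tendsto_ratio_of_bracket uR uR_rec (fun n hn => ⟨(ratio_bounds n hn).1, (ratio_bounds n hn).2.1⟩)

/-- **Exact growth rate of `uₙ`**: `log uₙ / n → log ((1+√5)/2)⁵ = 5 log((1+√5)/2) = 2.40605912…`.
[cite: Zudilin2003Catalan, Sect. 1, the display after Theorem 1 ("application of Poincaré's theorem (see also [Zu1, Proposition 2]) yields the limit relations lim u_n^(1/n) = lim v_n^(1/n) = ((1+√5)/2)^5 = exp(2.40605912…), lim |u_n G − v_n|^(1/n) = |(1−√5)/2|^5")] -/
theorem tendsto_log_u_div :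
    Tendsto (fun n : ℕ => Real.log (u n : ℝ) / n) atTop
      (𝓝 (Real.log (((1 + Real.sqrt 5) / 2) ^ 5))) :=
  tendsto_log_div_of_bracket uR uR_rec
    (fun n hn => ⟨(ratio_bounds n hn).1, (ratio_bounds n hn).2.1⟩) uR_pos

/-! ### `vₙ`: the same box `[15/2, 557/50]` -/

/-- `v₂ = 10699/1152`.
[cite: Zudilin2003Catalan, Sect. 1, the display after Theorem 1 ("application of Poincaré's theorem (see also [Zu1, Proposition 2]) yields the limit relations lim u_n^(1/n) = lim v_n^(1/n) = ((1+√5)/2)^5 = exp(2.40605912…), lim |u_n G − v_n|^(1/n) = |(1−√5)/2|^5")] -/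
theorem v_two : v 2 = 10699 / 1152 := by
  have h : v 2 = step 0 (v 0) (v 1) := by unfold v; exact sol_step _ _ 0
  rw [h]; unfold v; rw [sol_zero, sol_one]; norm_num [step, p, q]

/-- `v₃ = 8025653/115200`.
[cite: Zudilin2003Catalan, Sect. 1, the display after Theorem 1 ("application of Poincaré's theorem (see also [Zu1, Proposition 2]) yields the limit relations lim u_n^(1/n) = lim v_n^(1/n) = ((1+√5)/2)^5 = exp(2.40605912…), lim |u_n G − v_n|^(1/n) = |(1−√5)/2|^5")] -/
theorem v_three : v 3 = 8025653 / 115200 := by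
  have h : v 3 = step 1 (v 1) (v 2) := by unfold v; exact sol_step _ _ 1
  rw [h, v_two]; unfold v; rw [sol_one]; norm_num [step, p, q]

/-- **Kernel-certified ratio bracket for the numerators**: for `n ≥ 2`, `vₙ > 0` and
`(15/2) vₙ ≤ v_{n+1} ≤ (557/50) vₙ` (corner inequalities of `Zudilin2003Growth`, initial ratio
`v₃/v₂ = 7.5013…`).
[cite: Zudilin2003Catalan, Sect. 1, the display after Theorem 1 ("application of Poincaré's theorem (see also [Zu1, Proposition 2]) yields the limit relations lim u_n^(1/n) = lim v_n^(1/n) = ((1+√5)/2)^5 = exp(2.40605912…), lim |u_n G − v_n|^(1/n) = |(1−√5)/2|^5")] -/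
theorem vR_ratio_bounds :
    ∀ n, 2 ≤ n → 0 < vR n ∧ 15 / 2 * vR n ≤ vR (n + 1) ∧ vR (n + 1) ≤ 557 / 50 * vR n := by
  refine ratio_bounds_of_recurrence_neg vR sC tC 2 (fun m _ => vR_rec m) (fun m _ => tC_nonpos m)
    (by norm_num) (by norm_num) (fun m hm => corner_low m hm) (fun m hm => corner_up m hm) ?_ ?_ ?_
  · unfold vR; rw [v_two]; norm_num
  · unfold vR; rw [v_two, v_three]; norm_num
  · unfold vR; rw [v_two, v_three]; norm_num

/-- `vₙ > 0` for `n ≥ 1` (tree: `v_pos`).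
[cite: Zudilin2003Catalan, Sect. 1, the display after Theorem 1 ("application of Poincaré's theorem (see also [Zu1, Proposition 2]) yields the limit relations lim u_n^(1/n) = lim v_n^(1/n) = ((1+√5)/2)^5 = exp(2.40605912…), lim |u_n G − v_n|^(1/n) = |(1−√5)/2|^5")] -/
theorem vR_pos {n : ℕ} (hn : 1 ≤ n) : 0 < vR n := by
  unfold vR; exact_mod_cast v_pos hn

/-- **Exact ratio limit for the numerators**: `v_{n+1}/vₙ → ((1+√5)/2)⁵`.
[cite: Zudilin2003Catalan, Sect. 1, the display after Theorem 1 ("application of Poincaré's theorem (see also [Zu1, Proposition 2]) yields the limit relations lim u_n^(1/n) = lim v_n^(1/n) = ((1+√5)/2)^5 = exp(2.40605912…), lim |u_n G − v_n|^(1/n) = |(1−√5)/2|^5")] -/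
theorem tendsto_ratio_vR :
    Tendsto (fun n => vR (n + 1) / vR n) atTop (𝓝 (((1 + Real.sqrt 5) / 2) ^ 5)) :=
  tendsto_ratio_of_bracket vR vR_rec
    (fun n hn => ⟨(vR_ratio_bounds n hn).1, (vR_ratio_bounds n hn).2.1⟩)

/-- **Exact growth rate of `vₙ`**: `log vₙ / n → log ((1+√5)/2)⁵`.
[cite: Zudilin2003Catalan, Sect. 1, the display after Theorem 1 ("application of Poincaré's theorem (see also [Zu1, Proposition 2]) yields the limit relations lim u_n^(1/n) = lim v_n^(1/n) = ((1+√5)/2)^5 = exp(2.40605912…), lim |u_n G − v_n|^(1/n) = |(1−√5)/2|^5")] -/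
theorem tendsto_log_v_div :
    Tendsto (fun n : ℕ => Real.log (v n : ℝ) / n) atTop
      (𝓝 (Real.log (((1 + Real.sqrt 5) / 2) ^ 5))) := by
  have hl0 : (0 : ℝ) < ((1 + Real.sqrt 5) / 2) ^ 5 := by
    have := two_lt_sqrt_five; positivity
  have h := tendsto_log_abs_div_of_tendsto_ratio vR 2 (fun n hn => (vR_ratio_bounds n hn).1.ne')
    hl0.ne' tendsto_ratio_vR
  rw [abs_of_pos hl0] at h
  refine h.congr' ?_
  filter_upwards [eventually_ge_atTop 1] with n hn
  unfold vR; rw [abs_of_pos (by exact_mod_cast v_pos hn)]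

/-! ### The first conjunct of `Zudilin2003.rates`, as a theorem -/

/-- From `log wₙ / n → log λ` (`wₙ, λ > 0`) to `wₙ^{1/n} → λ`.
[cite: Zudilin2003Catalan, Sect. 1, the display after Theorem 1 ("application of Poincaré's theorem (see also [Zu1, Proposition 2]) yields the limit relations lim u_n^(1/n) = lim v_n^(1/n) = ((1+√5)/2)^5 = exp(2.40605912…), lim |u_n G − v_n|^(1/n) = |(1−√5)/2|^5")] -/
theorem tendsto_root_of_tendsto_log_div (w : ℕ → ℝ) {lam : ℝ} (hlam : 0 < lam)
    (hpos : ∀ n, 1 ≤ n → 0 < w n)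
    (h : Tendsto (fun n : ℕ => Real.log (w n) / n) atTop (𝓝 (Real.log lam))) :
    Tendsto (fun n : ℕ => w n ^ (1 / (n : ℝ))) atTop (𝓝 lam) := by
  have h1 : Tendsto (fun n : ℕ => Real.exp (Real.log (w n) / n)) atTop (𝓝 (Real.exp (Real.log lam))) :=
    (Real.continuous_exp.tendsto _).comp h
  rw [Real.exp_log hlam] at h1
  refine h1.congr' ?_
  filter_upwards [eventually_ge_atTop 1] with n hn
  rw [Real.rpow_def_of_pos (hpos n hn)]
  congr 1
  ring

/-- **Zudilin 2003, the growth rate stated after Theorem 1 — PROVED**: `uₙ^{1/n} → ((1+√5)/2)⁵`,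
literally the first conjunct of the tree's named fact `Zudilin2003.rates` (now unconditional; the
non-vanishing and decay conjuncts remain cited).
[cite: Zudilin2003Catalan, Sect. 1, the display after Theorem 1 ("application of Poincaré's theorem (see also [Zu1, Proposition 2]) yields the limit relations lim u_n^(1/n) = lim v_n^(1/n) = ((1+√5)/2)^5 = exp(2.40605912…), lim |u_n G − v_n|^(1/n) = |(1−√5)/2|^5")] -/
theorem tendsto_root_u :
    Tendsto (fun n : ℕ => ((u n : ℚ) : ℝ) ^ (1 / (n : ℝ))) atTop
      (𝓝 (((1 + Real.sqrt 5) / 2) ^ 5)) := by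
  have hl0 : (0 : ℝ) < ((1 + Real.sqrt 5) / 2) ^ 5 := by
    have := two_lt_sqrt_five; positivity
  exact tendsto_root_of_tendsto_log_div (fun n => (u n : ℝ)) hl0 (fun n _ => uR_pos n)
    tendsto_log_u_div

/-- The same for the numerators: `vₙ^{1/n} → ((1+√5)/2)⁵`.
[cite: Zudilin2003Catalan, Sect. 1, the display after Theorem 1 ("application of Poincaré's theorem (see also [Zu1, Proposition 2]) yields the limit relations lim u_n^(1/n) = lim v_n^(1/n) = ((1+√5)/2)^5 = exp(2.40605912…), lim |u_n G − v_n|^(1/n) = |(1−√5)/2|^5")] -/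
theorem tendsto_root_v :
    Tendsto (fun n : ℕ => ((v n : ℚ) : ℝ) ^ (1 / (n : ℝ))) atTop
      (𝓝 (((1 + Real.sqrt 5) / 2) ^ 5)) := by
  have hl0 : (0 : ℝ) < ((1 + Real.sqrt 5) / 2) ^ 5 := by
    have := two_lt_sqrt_five; positivity
  exact tendsto_root_of_tendsto_log_div (fun n => (v n : ℝ)) hl0 (fun n hn => vR_pos hn)
    tendsto_log_v_div

end Zudilin2003Growth

end Literature.NumberTheory.Irrationality.Zudilin2003

end

/-! ## (5/6) `TailSqueeze.lean` -/

section

open Filter Topology Finset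

namespace Literature.NumberTheory.Irrationality.Zudilin2003

namespace TailSqueeze

variable (r : ℕ → ℝ) {θ : ℝ} (n₀ : ℕ)

/-- Geometric shrinking propagates: `|d_{n+j}| ≤ θ^j |dₙ|` for `n ≥ n₀`.
[cite: Zudilin2003Catalan, Sect. 1, the display after Theorem 1 ("application of Poincaré's theorem … yields the limit relations") — generic second-order-recurrence tool of that application] -/
theorem abs_step_add_le (hθ0 : 0 ≤ θ)
    (hcontr : ∀ k, n₀ ≤ k → |r (k + 2) - r (k + 1)| ≤ θ * |r (k + 1) - r k|)
    (n : ℕ) (hn : n₀ ≤ n) (j : ℕ) :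
    |r (n + j + 1) - r (n + j)| ≤ θ ^ j * |r (n + 1) - r n| := by
  induction j with
  | zero => simp
  | succ j ih =>
    have h := hcontr (n + j) (by omega)
    rw [show n + (j + 1) + 1 = n + j + 2 by ring, show n + (j + 1) = n + j + 1 by ring, pow_succ]
    calc |r (n + j + 2) - r (n + j + 1)| ≤ θ * |r (n + j + 1) - r (n + j)| := h
      _ ≤ θ * (θ ^ j * |r (n + 1) - r n|) := mul_le_mul_of_nonneg_left ih hθ0
      _ = θ ^ j * θ * |r (n + 1) - r n| := by ring

/-- **Partial sums, upper**: `|r_{n+m} - rₙ| ≤ |dₙ| (1 - θ^m)/(1 - θ)` for `n ≥ n₀`.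
[cite: Zudilin2003Catalan, Sect. 1, the display after Theorem 1 ("application of Poincaré's theorem … yields the limit relations") — generic second-order-recurrence tool of that application] -/
theorem abs_sub_le_partial (hθ0 : 0 ≤ θ) (hθ1 : θ < 1)
    (hcontr : ∀ k, n₀ ≤ k → |r (k + 2) - r (k + 1)| ≤ θ * |r (k + 1) - r k|)
    (n : ℕ) (hn : n₀ ≤ n) (m : ℕ) :
    |r (n + m) - r n| ≤ |r (n + 1) - r n| * (1 - θ ^ m) / (1 - θ) := by
  have h1θ : 0 < 1 - θ := by linarith
  induction m with
  | zero => simp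
  | succ m ih =>
    have hstep := abs_step_add_le r n₀ hθ0 hcontr n hn m
    have htri : |r (n + (m + 1)) - r n| ≤ |r (n + m + 1) - r (n + m)| + |r (n + m) - r n| := by
      rw [show n + (m + 1) = n + m + 1 by ring]
      exact abs_sub_le _ _ _
    have halg : θ ^ m * |r (n + 1) - r n| + |r (n + 1) - r n| * (1 - θ ^ m) / (1 - θ) =
        |r (n + 1) - r n| * (1 - θ ^ (m + 1)) / (1 - θ) := by
      field_simp
      ring
    linarith

/-- **Partial sums, lower**: `(1 - 2θ)/(1 - θ) · |dₙ| ≤ |r_{n+1+m} - rₙ|` for `n ≥ n₀`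
(`|r_{n+1+m} - rₙ| ≥ |dₙ| - |r_{n+1+m} - r_{n+1}| ≥ |dₙ| - θ|dₙ|/(1-θ)`).
[cite: Zudilin2003Catalan, Sect. 1, the display after Theorem 1 ("application of Poincaré's theorem … yields the limit relations") — generic second-order-recurrence tool of that application] -/
theorem le_abs_sub_partial (hθ0 : 0 ≤ θ) (hθ1 : θ < 1)
    (hcontr : ∀ k, n₀ ≤ k → |r (k + 2) - r (k + 1)| ≤ θ * |r (k + 1) - r k|)
    (n : ℕ) (hn : n₀ ≤ n) (m : ℕ) :
    (1 - 2 * θ) / (1 - θ) * |r (n + 1) - r n| ≤ |r (n + 1 + m) - r n| := by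
  have h1θ : 0 < 1 - θ := by linarith
  have hup := abs_sub_le_partial r n₀ hθ0 hθ1 hcontr (n + 1) (by omega) m
  have hd1 : |r (n + 1 + 1) - r (n + 1)| ≤ θ * |r (n + 1) - r n| := by
    have := hcontr n hn
    rwa [show n + 2 = n + 1 + 1 by ring] at this
  have hpow : 0 ≤ θ ^ m := pow_nonneg hθ0 _
  have hd0 : 0 ≤ |r (n + 1) - r n| := abs_nonneg _
  -- `|r (n+1+m) - r (n+1)| ≤ θ |d n| / (1 - θ)`
  have htail : |r (n + 1 + m) - r (n + 1)| ≤ θ * |r (n + 1) - r n| / (1 - θ) := by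
    refine hup.trans (div_le_div_of_nonneg_right ?_ h1θ.le)
    nlinarith [abs_nonneg (r (n + 1 + 1) - r (n + 1))]
  -- reverse triangle inequality
  have hrev : |r (n + 1) - r n| - |r (n + 1 + m) - r (n + 1)| ≤ |r (n + 1 + m) - r n| := by
    have := abs_sub_abs_le_abs_sub (r (n + 1) - r n) (r (n + 1) - r (n + 1 + m))
    rw [show r (n + 1) - r n - (r (n + 1) - r (n + 1 + m)) = r (n + 1 + m) - r n by ring,
      abs_sub_comm (r (n + 1)) (r (n + 1 + m))] at this
    exact this
  have halg : (1 - 2 * θ) / (1 - θ) * |r (n + 1) - r n| =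
      |r (n + 1) - r n| - θ * |r (n + 1) - r n| / (1 - θ) := by
    field_simp
    ring
  rw [halg]
  linarith

variable {L : ℝ}

/-- **Tail squeeze, upper**: `|L - rₙ| ≤ |dₙ|/(1 - θ)` for `n ≥ n₀`.
[cite: Zudilin2003Catalan, Sect. 1, the display after Theorem 1 ("application of Poincaré's theorem … yields the limit relations") — generic second-order-recurrence tool of that application] -/
theorem abs_lim_sub_le (hθ0 : 0 ≤ θ) (hθ1 : θ < 1) (hlim : Tendsto r atTop (𝓝 L))
    (hcontr : ∀ k, n₀ ≤ k → |r (k + 2) - r (k + 1)| ≤ θ * |r (k + 1) - r k|)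
    (n : ℕ) (hn : n₀ ≤ n) : |L - r n| ≤ |r (n + 1) - r n| / (1 - θ) := by
  have h1θ : 0 < 1 - θ := by linarith
  have hl : Tendsto (fun m : ℕ => |r (n + m) - r n|) atTop (𝓝 |L - r n|) := by
    have h1 : Tendsto (fun m : ℕ => r (n + m)) atTop (𝓝 L) := by
      have := (tendsto_add_atTop_iff_nat n).2 hlim
      exact this.congr fun m => by rw [add_comm]
    exact (h1.sub_const _).abs
  refine le_of_tendsto hl (Eventually.of_forall fun m => ?_)
  refine (abs_sub_le_partial r n₀ hθ0 hθ1 hcontr n hn m).trans ?_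
  have hpow : 0 ≤ θ ^ m := pow_nonneg hθ0 _
  refine div_le_div_of_nonneg_right ?_ h1θ.le
  nlinarith [abs_nonneg (r (n + 1) - r n)]

/-- **Tail squeeze, lower**: `(1 - 2θ)/(1 - θ) · |dₙ| ≤ |L - rₙ|` for `n ≥ n₀`.
[cite: Zudilin2003Catalan, Sect. 1, the display after Theorem 1 ("application of Poincaré's theorem … yields the limit relations") — generic second-order-recurrence tool of that application] -/
theorem abs_lim_sub_ge (hθ0 : 0 ≤ θ) (hθ1 : θ < 1) (hlim : Tendsto r atTop (𝓝 L))
    (hcontr : ∀ k, n₀ ≤ k → |r (k + 2) - r (k + 1)| ≤ θ * |r (k + 1) - r k|)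
    (n : ℕ) (hn : n₀ ≤ n) : (1 - 2 * θ) / (1 - θ) * |r (n + 1) - r n| ≤ |L - r n| := by
  have hl : Tendsto (fun m : ℕ => |r (n + 1 + m) - r n|) atTop (𝓝 |L - r n|) := by
    have h1 : Tendsto (fun m : ℕ => r (n + 1 + m)) atTop (𝓝 L) := by
      have := (tendsto_add_atTop_iff_nat (n + 1)).2 hlim
      exact this.congr fun m => by rw [add_comm]
    exact (h1.sub_const _).abs
  exact ge_of_tendsto hl (Eventually.of_forall fun m => le_abs_sub_partial r n₀ hθ0 hθ1 hcontr n hn m)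

/-- **Non-vanishing**: for `θ < 1/2` and `dₙ ≠ 0`, `L ≠ rₙ` (`n ≥ n₀`).
[cite: Zudilin2003Catalan, Sect. 1, the display after Theorem 1 ("application of Poincaré's theorem … yields the limit relations") — generic second-order-recurrence tool of that application] -/
theorem lim_sub_ne_zero (hθ0 : 0 ≤ θ) (hθ : θ < 1 / 2) (hlim : Tendsto r atTop (𝓝 L))
    (hcontr : ∀ k, n₀ ≤ k → |r (k + 2) - r (k + 1)| ≤ θ * |r (k + 1) - r k|)
    (n : ℕ) (hn : n₀ ≤ n) (hd : r (n + 1) ≠ r n) : L - r n ≠ 0 := by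
  have h := abs_lim_sub_ge r n₀ hθ0 (by linarith) hlim hcontr n hn
  have hc : 0 < (1 - 2 * θ) / (1 - θ) := div_pos (by linarith) (by linarith)
  have hd' : 0 < |r (n + 1) - r n| := abs_pos.2 (sub_ne_zero.2 hd)
  intro h0
  rw [h0, abs_zero] at h
  nlinarith [mul_pos hc hd']

/-- **Exact rate**: for `θ < 1/2`, if `log|dₙ|/n → ρ` then `log|L - rₙ|/n → ρ`.
[cite: Zudilin2003Catalan, Sect. 1, the display after Theorem 1 ("application of Poincaré's theorem … yields the limit relations") — generic second-order-recurrence tool of that application] -/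
theorem tendsto_log_abs_lim_sub_div (hθ0 : 0 ≤ θ) (hθ : θ < 1 / 2) (hlim : Tendsto r atTop (𝓝 L))
    (hcontr : ∀ k, n₀ ≤ k → |r (k + 2) - r (k + 1)| ≤ θ * |r (k + 1) - r k|)
    (hd : ∀ k, n₀ ≤ k → r (k + 1) ≠ r k) {ρ : ℝ}
    (hrate : Tendsto (fun n : ℕ => Real.log |r (n + 1) - r n| / n) atTop (𝓝 ρ)) :
    Tendsto (fun n : ℕ => Real.log |L - r n| / n) atTop (𝓝 ρ) := by
  have hθ1 : θ < 1 := by linarith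
  have h1θ : 0 < 1 - θ := by linarith
  have hc : 0 < (1 - 2 * θ) / (1 - θ) := div_pos (by linarith) h1θ
  -- lower companion `(log|dₙ| + log c)/n`, upper companion `(log|dₙ| + log (1/(1-θ)))/n`
  have hlow : Tendsto (fun n : ℕ => Real.log |r (n + 1) - r n| / n +
      Real.log ((1 - 2 * θ) / (1 - θ)) / n) atTop (𝓝 ρ) := by
    have hc' : Tendsto (fun n : ℕ => Real.log ((1 - 2 * θ) / (1 - θ)) / (n : ℝ)) atTop (𝓝 0) :=
      tendsto_const_nhds.div_atTop tendsto_natCast_atTop_atTop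
    have := hrate.add hc'
    rwa [add_zero] at this
  have hup : Tendsto (fun n : ℕ => Real.log |r (n + 1) - r n| / n +
      Real.log (1 / (1 - θ)) / n) atTop (𝓝 ρ) := by
    have hc' : Tendsto (fun n : ℕ => Real.log (1 / (1 - θ)) / (n : ℝ)) atTop (𝓝 0) :=
      tendsto_const_nhds.div_atTop tendsto_natCast_atTop_atTop
    have := hrate.add hc'
    rwa [add_zero] at this
  refine tendsto_of_tendsto_of_tendsto_of_le_of_le' hlow hup ?_ ?_
  · filter_upwards [eventually_ge_atTop n₀, eventually_ge_atTop 1] with n hn h1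
    have hn0 : (0 : ℝ) < n := by exact_mod_cast h1
    have hdn : 0 < |r (n + 1) - r n| := abs_pos.2 (sub_ne_zero.2 (hd n hn))
    rw [← add_div, ← Real.log_mul hdn.ne' hc.ne']
    refine div_le_div_of_nonneg_right (Real.log_le_log (mul_pos hdn hc) ?_) hn0.le
    rw [mul_comm]
    exact abs_lim_sub_ge r n₀ hθ0 hθ1 hlim hcontr n hn
  · filter_upwards [eventually_ge_atTop n₀, eventually_ge_atTop 1] with n hn h1
    have hn0 : (0 : ℝ) < n := by exact_mod_cast h1
    have hdn : 0 < |r (n + 1) - r n| := abs_pos.2 (sub_ne_zero.2 (hd n hn))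
    have he : 0 < |L - r n| := abs_pos.2 (lim_sub_ne_zero r n₀ hθ0 hθ hlim hcontr n hn (hd n hn))
    rw [← add_div, ← Real.log_mul hdn.ne' (by positivity)]
    refine div_le_div_of_nonneg_right (Real.log_le_log he ?_) hn0.le
    rw [← div_eq_mul_one_div]
    exact abs_lim_sub_le r n₀ hθ0 hθ1 hlim hcontr n hn

end TailSqueeze

end Literature.NumberTheory.Irrationality.Zudilin2003

end

/-! ## (6/6) `Zudilin2003ExactDecay.lean` -/

section

open Filter Topology Finset
open Literature.NumberTheory.Irrationality.Zudilin2003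
open Literature.NumberTheory.Transcendental
open Literature.Analysis.Asymptotics.PoincareRecurrence

namespace Literature.NumberTheory.Irrationality.Zudilin2003

namespace Zudilin2003Growth

/-! ### The Casoratian and the steps of the approximants -/

/-- The Casoratian `Wₙ = uₙv_{n+1} - u_{n+1}vₙ` (real).
[cite: Zudilin2003Catalan, Sect. 1, the display after Theorem 1 ("application of Poincaré's theorem (see also [Zu1, Proposition 2]) yields the limit relations lim u_n^(1/n) = lim v_n^(1/n) = ((1+√5)/2)^5 = exp(2.40605912…), lim |u_n G − v_n|^(1/n) = |(1−√5)/2|^5")] -/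
def casW (n : ℕ) : ℝ := uR n * vR (n + 1) - uR (n + 1) * vR n

/-- The approximants `rₙ = vₙ/uₙ`.
[cite: Zudilin2003Catalan, Sect. 1, the display after Theorem 1 ("application of Poincaré's theorem (see also [Zu1, Proposition 2]) yields the limit relations lim u_n^(1/n) = lim v_n^(1/n) = ((1+√5)/2)^5 = exp(2.40605912…), lim |u_n G − v_n|^(1/n) = |(1−√5)/2|^5")] -/
def approx (n : ℕ) : ℝ := vR n / uR n

/-- Abel, one step: `W_{n+1} = tₙ Wₙ`.
[cite: Zudilin2003Catalan, Sect. 1, the display after Theorem 1 ("application of Poincaré's theorem (see also [Zu1, Proposition 2]) yields the limit relations lim u_n^(1/n) = lim v_n^(1/n) = ((1+√5)/2)^5 = exp(2.40605912…), lim |u_n G − v_n|^(1/n) = |(1−√5)/2|^5")] -/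
theorem casW_succ (n : ℕ) : casW (n + 1) = tC n * casW n := by
  unfold casW
  rw [show n + 1 + 1 = n + 2 by ring]
  exact casoratian_succ uR vR sC tC n (uR_rec n) (vR_rec n)

/-- `Wₙ ≠ 0`.
[cite: Zudilin2003Catalan, Sect. 1, the display after Theorem 1 ("application of Poincaré's theorem (see also [Zu1, Proposition 2]) yields the limit relations lim u_n^(1/n) = lim v_n^(1/n) = ((1+√5)/2)^5 = exp(2.40605912…), lim |u_n G − v_n|^(1/n) = |(1−√5)/2|^5")] -/
theorem casW_ne_zero (n : ℕ) : casW n ≠ 0 := casoratian_ne_zero n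

/-- `r_{n+1} - rₙ = Wₙ/(uₙu_{n+1})`.
[cite: Zudilin2003Catalan, Sect. 1, the display after Theorem 1 ("application of Poincaré's theorem (see also [Zu1, Proposition 2]) yields the limit relations lim u_n^(1/n) = lim v_n^(1/n) = ((1+√5)/2)^5 = exp(2.40605912…), lim |u_n G − v_n|^(1/n) = |(1−√5)/2|^5")] -/
theorem step_eq (n : ℕ) : approx (n + 1) - approx n = casW n / (uR n * uR (n + 1)) := by
  have h0 := (uR_pos n).ne'
  have h1 := (uR_pos (n + 1)).ne'
  unfold approx casW
  field_simp

/-- The steps never vanish.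
[cite: Zudilin2003Catalan, Sect. 1, the display after Theorem 1 ("application of Poincaré's theorem (see also [Zu1, Proposition 2]) yields the limit relations lim u_n^(1/n) = lim v_n^(1/n) = ((1+√5)/2)^5 = exp(2.40605912…), lim |u_n G − v_n|^(1/n) = |(1−√5)/2|^5")] -/
theorem step_ne_zero (n : ℕ) : approx (n + 1) ≠ approx n := by
  intro h
  have h2 := step_eq n
  rw [h, sub_self] at h2
  exact div_ne_zero (casW_ne_zero n) (mul_pos (uR_pos n) (uR_pos (n + 1))).ne' h2.symm

/-- `r_{n+2} - r_{n+1} = (r_{n+1} - rₙ) · tₙuₙ/u_{n+2}`.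
[cite: Zudilin2003Catalan, Sect. 1, the display after Theorem 1 ("application of Poincaré's theorem (see also [Zu1, Proposition 2]) yields the limit relations lim u_n^(1/n) = lim v_n^(1/n) = ((1+√5)/2)^5 = exp(2.40605912…), lim |u_n G − v_n|^(1/n) = |(1−√5)/2|^5")] -/
theorem step_succ (n : ℕ) :
    approx (n + 2) - approx (n + 1) = (approx (n + 1) - approx n) * (tC n * uR n / uR (n + 2)) := by
  have h0 := (uR_pos n).ne'
  have h1 := (uR_pos (n + 1)).ne'
  have h2 := (uR_pos (n + 2)).ne'
  rw [show n + 2 = n + 1 + 1 by ring, step_eq (n + 1), step_eq n, casW_succ n,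
    show n + 1 + 1 = n + 2 by ring]
  field_simp

/-- `uR 0 = 1`, `uR 1 = 7/4`, `uR 2 = 649/64`, `uR 3 = 19471/256`.
[cite: Zudilin2003Catalan, Sect. 1, the display after Theorem 1 ("application of Poincaré's theorem (see also [Zu1, Proposition 2]) yields the limit relations lim u_n^(1/n) = lim v_n^(1/n) = ((1+√5)/2)^5 = exp(2.40605912…), lim |u_n G − v_n|^(1/n) = |(1−√5)/2|^5")] -/
theorem uR_values : uR 0 = 1 ∧ uR 1 = 7 / 4 ∧ uR 2 = 649 / 64 ∧ uR 3 = 19471 / 256 := by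
  unfold uR
  refine ⟨?_, ?_, ?_, ?_⟩
  · unfold u; rw [sol_zero]; norm_num
  · unfold u; rw [sol_one]; norm_num
  · rw [u_two]; norm_num
  · rw [u_three]; norm_num

/-- **The contraction factor**: `|tₙ| uₙ/u_{n+2} ≤ 1/50` for every `n`
(`n ≥ 2`: `|tₙ| ≤ 1`, `u_{n+2} ≥ (15/2)² uₙ`; `n = 0, 1`: `0.0137…`, `0.0088…` by evaluation).
[cite: Zudilin2003Catalan, Sect. 1, the display after Theorem 1 ("application of Poincaré's theorem (see also [Zu1, Proposition 2]) yields the limit relations lim u_n^(1/n) = lim v_n^(1/n) = ((1+√5)/2)^5 = exp(2.40605912…), lim |u_n G − v_n|^(1/n) = |(1−√5)/2|^5")] -/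
theorem contraction_le (n : ℕ) : |tC n| * uR n / uR (n + 2) ≤ 1 / 50 := by
  have hu2 := uR_pos (n + 2)
  rw [div_le_iff₀ hu2]
  rcases Nat.lt_or_ge n 2 with hlt | hge
  · interval_cases n
    · obtain ⟨h0, -, h2, -⟩ := uR_values
      have ht : |tC 0| = 5 / 36 := by
        unfold tC TC LC; simp only [p]; norm_num
      rw [ht, h0, show (0 + 2 : ℕ) = 2 from rfl, h2]; norm_num
    · obtain ⟨-, h1, -, h3⟩ := uR_values
      have ht : |tC 1| = 22608 / 58500 := by
        unfold tC TC LC; simp only [p]; norm_num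
      rw [ht, h1, show (1 + 2 : ℕ) = 3 from rfl, h3]; norm_num
  · have ht := abs_tC_le_one n
    have hu0 := uR_pos n
    have hg1 := (ratio_bounds n hge).2.1
    have hg2 := (ratio_bounds (n + 1) (by omega)).2.1
    rw [show n + 1 + 1 = n + 2 by ring] at hg2
    have hu2' : (15 / 2 : ℝ) ^ 2 * uR n ≤ uR (n + 2) := by nlinarith
    have : |tC n| * uR n ≤ uR n := by nlinarith [abs_nonneg (tC n)]
    nlinarith

/-- **Geometric shrinking of the steps**: `|r_{k+2} - r_{k+1}| ≤ (1/50)|r_{k+1} - r_k|` for all `k`.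
[cite: Zudilin2003Catalan, Sect. 1, the display after Theorem 1 ("application of Poincaré's theorem (see also [Zu1, Proposition 2]) yields the limit relations lim u_n^(1/n) = lim v_n^(1/n) = ((1+√5)/2)^5 = exp(2.40605912…), lim |u_n G − v_n|^(1/n) = |(1−√5)/2|^5")] -/
theorem abs_step_succ_le (k : ℕ) (_hk : 0 ≤ k) :
    |approx (k + 2) - approx (k + 1)| ≤ 1 / 50 * |approx (k + 1) - approx k| := by
  rw [step_succ k, abs_mul, mul_comm]
  refine mul_le_mul_of_nonneg_right ?_ (abs_nonneg _)
  rw [abs_div, abs_mul, abs_of_pos (uR_pos k), abs_of_pos (uR_pos (k + 2))]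
  exact contraction_le k

/-! ### Exact rates of the Casoratian and of the steps -/

/-- `log|Wₙ|/n → 0` (`W_{n+1}/Wₙ = tₙ → -1`, Elaydi's Lemma 7.14).
[cite: Zudilin2003Catalan, Sect. 1, the display after Theorem 1 ("application of Poincaré's theorem (see also [Zu1, Proposition 2]) yields the limit relations lim u_n^(1/n) = lim v_n^(1/n) = ((1+√5)/2)^5 = exp(2.40605912…), lim |u_n G − v_n|^(1/n) = |(1−√5)/2|^5")] -/
theorem tendsto_log_abs_casW_div : Tendsto (fun n : ℕ => Real.log |casW n| / n) atTop (𝓝 0) := by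
  have h := tendsto_log_abs_div_of_tendsto_ratio casW 0 (fun n _ => casW_ne_zero n)
    (show (-1 : ℝ) ≠ 0 by norm_num) (tendsto_tC.congr fun n => by
      rw [casW_succ, mul_div_cancel_right₀ _ (casW_ne_zero n)])
  simpa using h

/-- `log u_{n+1} / n → log λ∞`.
[cite: Zudilin2003Catalan, Sect. 1, the display after Theorem 1 ("application of Poincaré's theorem (see also [Zu1, Proposition 2]) yields the limit relations lim u_n^(1/n) = lim v_n^(1/n) = ((1+√5)/2)^5 = exp(2.40605912…), lim |u_n G − v_n|^(1/n) = |(1−√5)/2|^5")] -/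
theorem tendsto_log_u_succ_div :
    Tendsto (fun n : ℕ => Real.log (uR (n + 1)) / n) atTop
      (𝓝 (Real.log (((1 + Real.sqrt 5) / 2) ^ 5))) := by
  have hl0 : (0 : ℝ) < ((1 + Real.sqrt 5) / 2) ^ 5 := by
    have := two_lt_sqrt_five; positivity
  have h1 : Tendsto (fun n : ℕ => Real.log (uR (n + 1) / uR n)) atTop
      (𝓝 (Real.log (((1 + Real.sqrt 5) / 2) ^ 5))) := tendsto_ratio_uR.log hl0.ne'
  have h2 : Tendsto (fun n : ℕ => Real.log (uR (n + 1) / uR n) / n) atTop (𝓝 0) :=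
    h1.div_atTop tendsto_natCast_atTop_atTop
  have h3 := tendsto_log_u_div.add h2
  rw [add_zero] at h3
  refine h3.congr fun n => ?_
  have hu0 := uR_pos n
  have hu1 := uR_pos (n + 1)
  show Real.log (u n : ℝ) / n + Real.log (uR (n + 1) / uR n) / n = Real.log (uR (n + 1)) / n
  rw [← add_div, Real.log_div hu1.ne' hu0.ne']
  unfold uR
  ring

/-- **Exact rate of the steps**: `log|r_{n+1} - rₙ|/n → -2 log λ∞`.
[cite: Zudilin2003Catalan, Sect. 1, the display after Theorem 1 ("application of Poincaré's theorem (see also [Zu1, Proposition 2]) yields the limit relations lim u_n^(1/n) = lim v_n^(1/n) = ((1+√5)/2)^5 = exp(2.40605912…), lim |u_n G − v_n|^(1/n) = |(1−√5)/2|^5")] -/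
theorem tendsto_log_abs_step_div :
    Tendsto (fun n : ℕ => Real.log |approx (n + 1) - approx n| / n) atTop
      (𝓝 (-2 * Real.log (((1 + Real.sqrt 5) / 2) ^ 5))) := by
  have h := (tendsto_log_abs_casW_div.sub tendsto_log_u_div).sub tendsto_log_u_succ_div
  have e : (0 : ℝ) - Real.log (((1 + Real.sqrt 5) / 2) ^ 5) - Real.log (((1 + Real.sqrt 5) / 2) ^ 5) =
      -2 * Real.log (((1 + Real.sqrt 5) / 2) ^ 5) := by ring
  rw [e] at h
  refine h.congr fun n => ?_
  have hu0 := uR_pos n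
  have hu1 := uR_pos (n + 1)
  have hW := abs_pos.2 (casW_ne_zero n)
  show Real.log |casW n| / n - Real.log (u n : ℝ) / n - Real.log (uR (n + 1)) / n =
    Real.log |approx (n + 1) - approx n| / n
  rw [step_eq n, abs_div, abs_mul, abs_of_pos hu0, abs_of_pos hu1,
    Real.log_div hW.ne' (mul_pos hu0 hu1).ne', Real.log_mul hu0.ne' hu1.ne']
  unfold uR
  ring

/-! ### The limit `L` of `vₙ/uₙ`: non-vanishing and exact decay of `uₙL - vₙ` -/

/-- `((√5-1)/2)⁵ = (((1+√5)/2)⁵)⁻¹`.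
[cite: Zudilin2003Catalan, Sect. 1, the display after Theorem 1 ("application of Poincaré's theorem (see also [Zu1, Proposition 2]) yields the limit relations lim u_n^(1/n) = lim v_n^(1/n) = ((1+√5)/2)^5 = exp(2.40605912…), lim |u_n G − v_n|^(1/n) = |(1−√5)/2|^5")] -/
theorem golden_conj_fifth : ((Real.sqrt 5 - 1) / 2) ^ 5 = ((((1 + Real.sqrt 5) / 2) ^ 5))⁻¹ := by
  have hs : Real.sqrt 5 ^ 2 = 5 := Real.sq_sqrt (by norm_num)
  rw [← inv_pow]
  congr 1
  refine eq_inv_of_mul_eq_one_left ?_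
  nlinarith

variable {L : ℝ}

/-- **Non-vanishing**: if `vₙ/uₙ → L` then `uₙL - vₙ ≠ 0` for EVERY `n`.
[cite: Zudilin2003Catalan, Sect. 1, the display after Theorem 1 ("application of Poincaré's theorem (see also [Zu1, Proposition 2]) yields the limit relations lim u_n^(1/n) = lim v_n^(1/n) = ((1+√5)/2)^5 = exp(2.40605912…), lim |u_n G − v_n|^(1/n) = |(1−√5)/2|^5")] -/
theorem form_ne_zero_of_tendsto (hL : Tendsto (fun n : ℕ => vR n / uR n) atTop (𝓝 L)) (n : ℕ) :
    uR n * L - vR n ≠ 0 := by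
  have h := TailSqueeze.lim_sub_ne_zero approx 0 (θ := 1 / 50) (by norm_num) (by norm_num) hL
    abs_step_succ_le n (Nat.zero_le n) (step_ne_zero n)
  have hu := (uR_pos n).ne'
  unfold approx at h
  intro h0
  apply h
  field_simp
  linarith

/-- **Exact approximation rate**: if `vₙ/uₙ → L` then `log|L - vₙ/uₙ|/n → -2 log λ∞`.
[cite: Zudilin2003Catalan, Sect. 1, the display after Theorem 1 ("application of Poincaré's theorem (see also [Zu1, Proposition 2]) yields the limit relations lim u_n^(1/n) = lim v_n^(1/n) = ((1+√5)/2)^5 = exp(2.40605912…), lim |u_n G − v_n|^(1/n) = |(1−√5)/2|^5")] -/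
theorem tendsto_log_abs_sub_div_of_tendsto (hL : Tendsto (fun n : ℕ => vR n / uR n) atTop (𝓝 L)) :
    Tendsto (fun n : ℕ => Real.log |L - vR n / uR n| / n) atTop
      (𝓝 (-2 * Real.log (((1 + Real.sqrt 5) / 2) ^ 5))) :=
  TailSqueeze.tendsto_log_abs_lim_sub_div approx 0 (θ := 1 / 50) (by norm_num) (by norm_num) hL
    abs_step_succ_le (fun k _ => step_ne_zero k) tendsto_log_abs_step_div

/-- **Exact decay of the forms**: if `vₙ/uₙ → L` then `log|uₙL - vₙ|/n → -log λ∞ = -2.40605912…`.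
[cite: Zudilin2003Catalan, Sect. 1, the display after Theorem 1 ("application of Poincaré's theorem (see also [Zu1, Proposition 2]) yields the limit relations lim u_n^(1/n) = lim v_n^(1/n) = ((1+√5)/2)^5 = exp(2.40605912…), lim |u_n G − v_n|^(1/n) = |(1−√5)/2|^5")] -/
theorem tendsto_log_abs_form_div_of_tendsto (hL : Tendsto (fun n : ℕ => vR n / uR n) atTop (𝓝 L)) :
    Tendsto (fun n : ℕ => Real.log |uR n * L - vR n| / n) atTop
      (𝓝 (-Real.log (((1 + Real.sqrt 5) / 2) ^ 5))) := by
  have h := tendsto_log_u_div.add (tendsto_log_abs_sub_div_of_tendsto hL)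
  have e : Real.log (((1 + Real.sqrt 5) / 2) ^ 5) + -2 * Real.log (((1 + Real.sqrt 5) / 2) ^ 5) =
      -Real.log (((1 + Real.sqrt 5) / 2) ^ 5) := by ring
  rw [e] at h
  refine h.congr fun n => ?_
  have hu := uR_pos n
  have hid : uR n * L - vR n = uR n * (L - vR n / uR n) := by field_simp
  show Real.log (u n : ℝ) / n + Real.log |L - vR n / uR n| / n = Real.log |uR n * L - vR n| / n
  by_cases h0 : L - vR n / uR n = 0
  · exfalso; exact form_ne_zero_of_tendsto hL n (by rw [hid, h0, mul_zero])
  · rw [hid, abs_mul, abs_of_pos hu, Real.log_mul hu.ne' (abs_ne_zero.2 h0), add_div]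
    rfl

/-- **`|uₙL - vₙ|^{1/n} → ((√5-1)/2)⁵`** if `vₙ/uₙ → L`.
[cite: Zudilin2003Catalan, Sect. 1, the display after Theorem 1 ("application of Poincaré's theorem (see also [Zu1, Proposition 2]) yields the limit relations lim u_n^(1/n) = lim v_n^(1/n) = ((1+√5)/2)^5 = exp(2.40605912…), lim |u_n G − v_n|^(1/n) = |(1−√5)/2|^5")] -/
theorem tendsto_root_abs_form_of_tendsto (hL : Tendsto (fun n : ℕ => vR n / uR n) atTop (𝓝 L)) :
    Tendsto (fun n : ℕ => |uR n * L - vR n| ^ (1 / (n : ℝ))) atTop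
      (𝓝 (((Real.sqrt 5 - 1) / 2) ^ 5)) := by
  have hl0 : (0 : ℝ) < ((1 + Real.sqrt 5) / 2) ^ 5 := by
    have := two_lt_sqrt_five; positivity
  have h1 := (Real.continuous_exp.tendsto _).comp (tendsto_log_abs_form_div_of_tendsto hL)
  rw [Real.exp_neg, Real.exp_log hl0, ← golden_conj_fifth] at h1
  refine h1.congr' ?_
  filter_upwards [eventually_ge_atTop 1] with n hn
  have hf := abs_pos.2 (form_ne_zero_of_tendsto hL n)
  simp only [Function.comp]
  rw [Real.rpow_def_of_pos hf]
  congr 1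
  ring

/-! ### `theorem1 → rates` -/

/-- **The rates follow from the identification of the limit.** If `vₙ/uₙ → G`, all three conjuncts
of the cited `Zudilin2003.rates` hold.
[cite: Zudilin2003Catalan, Sect. 1, the display after Theorem 1 ("application of Poincaré's theorem (see also [Zu1, Proposition 2]) yields the limit relations lim u_n^(1/n) = lim v_n^(1/n) = ((1+√5)/2)^5 = exp(2.40605912…), lim |u_n G − v_n|^(1/n) = |(1−√5)/2|^5")] -/
theorem rates_of_tendsto (hG : Tendsto (fun n : ℕ => vR n / uR n) atTop (𝓝 catalanConstant)) :
    rates := by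
  refine ⟨tendsto_root_u, fun n => ?_, ?_⟩
  · have h := form_ne_zero_of_tendsto hG n
    unfold form; unfold uR vR at h; exact h
  · have h := tendsto_root_abs_form_of_tendsto hG
    refine h.congr fun n => ?_
    unfold form uR vR
    rfl

/-- **`Zudilin2003.theorem1 → Zudilin2003.rates`**: the cited rates are a COROLLARY of the cited
Theorem 1 (only its last clause `vₙ/uₙ → G` is used) — growth by Poincaré, non-vanishing and decay
by the tail squeeze.
[cite: Zudilin2003Catalan, Sect. 1, the display after Theorem 1 ("application of Poincaré's theorem (see also [Zu1, Proposition 2]) yields the limit relations lim u_n^(1/n) = lim v_n^(1/n) = ((1+√5)/2)^5 = exp(2.40605912…), lim |u_n G − v_n|^(1/n) = |(1−√5)/2|^5")] -/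
theorem rates_of_theorem1 (h : theorem1) : rates := by
  refine rates_of_tendsto (h.2.congr fun n => ?_)
  unfold vR uR
  push_cast
  rfl

end Zudilin2003Growth

end Literature.NumberTheory.Irrationality.Zudilin2003

end

/-! ## (closing) `Zudilin2003Rates.lean`, first block: the rates are UNCONDITIONAL -/

section

open Filter Topology
open Literature.NumberTheory.Transcendental

namespace Literature.NumberTheory.Irrationality.Zudilin2003

namespace Zudilin2003Growth

/-- **`vₙ/uₙ → G`** (`Zudilin2003.tendsto_v_div_u` of `CatalanSeries.lean`, Zudilin 2003 Sect. 2, Lemmas 1–5), in the `uR, vR`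
normalisation. [cite: Zudilin2003Catalan, Theorem 1 ("lim v_n/u_n = G")] -/
theorem tendsto_vR_div_uR : Tendsto (fun n : ℕ => vR n / uR n) atTop (𝓝 catalanConstant) := by
  refine tendsto_v_div_u.congr fun n => ?_
  unfold vR uR
  push_cast
  rfl

end Zudilin2003Growth

/-- **`Zudilin2003.rates` holds** (the named fact of `CatalanRecursion.lean` is a theorem): `uₙ^{1/n} → ((1+√5)/2)⁵`,
`uₙG − vₙ ≠ 0` for every `n`, `|uₙG − vₙ|^{1/n} → ((√5−1)/2)⁵`.
[cite: Zudilin2003Catalan, Sect. 1, the display after Theorem 1 ("application of Poincaré's theorem (see also [Zu1, Proposition 2]) yields the limit relations lim u_n^(1/n) = lim v_n^(1/n) = ((1+√5)/2)^5 = exp(2.40605912…), lim |u_n G − v_n|^(1/n) = |(1−√5)/2|^5")] -/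
theorem rates_holds : rates := Zudilin2003Growth.rates_of_tendsto Zudilin2003Growth.tendsto_vR_div_uR

namespace Zudilin2003Growth

/-- **`uₙG - vₙ ≠ 0` for every `n`.**
[cite: Zudilin2003Catalan, Sect. 1, the display after Theorem 1 ("application of Poincaré's theorem (see also [Zu1, Proposition 2]) yields the limit relations lim u_n^(1/n) = lim v_n^(1/n) = ((1+√5)/2)^5 = exp(2.40605912…), lim |u_n G − v_n|^(1/n) = |(1−√5)/2|^5")] -/
theorem form_ne_zero (n : ℕ) : form n ≠ 0 := rates_holds.2.1 n

/-- **`|uₙG - vₙ|^{1/n} → ((√5-1)/2)⁵ = e^{-2.40605912…}`.**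
[cite: Zudilin2003Catalan, Sect. 1, the display after Theorem 1 ("application of Poincaré's theorem (see also [Zu1, Proposition 2]) yields the limit relations lim u_n^(1/n) = lim v_n^(1/n) = ((1+√5)/2)^5 = exp(2.40605912…), lim |u_n G − v_n|^(1/n) = |(1−√5)/2|^5")] -/
theorem tendsto_root_abs_form :
    Tendsto (fun n : ℕ => |form n| ^ (1 / (n : ℝ))) atTop (𝓝 (((Real.sqrt 5 - 1) / 2) ^ 5)) :=
  rates_holds.2.2

/-- **`log|uₙG - vₙ|/n → -log ((1+√5)/2)⁵`.**
[cite: Zudilin2003Catalan, Sect. 1, the display after Theorem 1 ("application of Poincaré's theorem (see also [Zu1, Proposition 2]) yields the limit relations lim u_n^(1/n) = lim v_n^(1/n) = ((1+√5)/2)^5 = exp(2.40605912…), lim |u_n G − v_n|^(1/n) = |(1−√5)/2|^5")] -/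
theorem tendsto_log_abs_form_div :
    Tendsto (fun n : ℕ => Real.log |form n| / n) atTop (𝓝 (-Real.log (((1 + Real.sqrt 5) / 2) ^ 5))) := by
  refine (tendsto_log_abs_form_div_of_tendsto tendsto_vR_div_uR).congr fun n => ?_
  unfold form uR vR
  rfl

/-- **`log|G - vₙ/uₙ|/n → -2 log ((1+√5)/2)⁵`** (the approximations `vₙ/uₙ` of the source's table; "the rational
approximations v_n/u_n to Catalan's constant converge quite rapidly (for instance, |v_10/u_10 − G| < 10^{−20})").
[cite: Zudilin2003Catalan, Sect. 1, the display after Theorem 1 ("application of Poincaré's theorem (see also [Zu1, Proposition 2]) yields the limit relations lim u_n^(1/n) = lim v_n^(1/n) = ((1+√5)/2)^5 = exp(2.40605912…), lim |u_n G − v_n|^(1/n) = |(1−√5)/2|^5")] -/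
theorem tendsto_log_abs_sub_catalan_div :
    Tendsto (fun n : ℕ => Real.log |catalanConstant - vR n / uR n| / n) atTop
      (𝓝 (-2 * Real.log (((1 + Real.sqrt 5) / 2) ^ 5))) :=
  tendsto_log_abs_sub_div_of_tendsto tendsto_vR_div_uR

/-- **Effective approximation bound, unconditional**:
`|G - v_{2+m}/u_{2+m}| ≤ (13/8)/((649/64)²·(15/2)) · (4/225)^m / (1 - 4/225)`.
[cite: Zudilin2003Catalan, Sect. 1 ("the rational approximations v_n/u_n to Catalan's constant converge quite rapidly")] -/
theorem abs_sub_catalan_le (m : ℕ) :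
    |catalanConstant - vR (2 + m) / uR (2 + m)| ≤
      13 / 8 / ((649 / 64) ^ 2 * (15 / 2)) * (4 / 225) ^ m / (1 - 4 / 225) :=
  abs_sub_catalan_le_of_theorem1 theorem1_holds m

end Zudilin2003Growth

end Literature.NumberTheory.Irrationality.Zudilin2003

end

end
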